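import Literature.Probability.RandomPlanarGeometry.HexSAWStripIdentity
import Mathlib.Analysis.SpecificLimits.Basic
import Mathlib.Algebra.BigOperators.Option
import HarnessLib

/-!
# The width-two strip of the hexagonal lattice: `B₂(x_c) = (30√2 − 6)/49` and `A₂(x_c) = x_c(50√2 − 10)/49`

Topic `Literature/Probability/RandomPlanarGeometry` (continues `HexSAWStrip.lean` — Duminil-Copin–Smirnov's
strip domains `HV.stripV T L`, mid-edge walks `HV.IsMidWalk`/`HV.midWalks`, the boundary classes
`HV.IsAlphaDart`/`HV.IsBetaDart`, the partition functions `HV.stripA`/`HV.stripB` —, `HexSAWLowerBound.lean` —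
`HV.stripAlim T = A_T(x_c) = sup_L A_{T,L}(x_c)`, `HV.stripBlim T = B_T(x_c) = sup_L B_{T,L}(x_c)` — and
`HexSAWStripIdentity.lean` — `strip_identity_lim : cos(3π/8)·A_T + B_T = 1`, i.e. Lemma 2 in the limit
`L → ∞` with `E_T = 0`). Source: H. Duminil-Copin, S. Smirnov, *The connective constant of the honeycomb
lattice equals `√(2+√2)`*, Ann. of Math. 175 (2012), 1653–1665, §3 (the strips `S_T`, the partition
functions `A_T`, `B_T`, Lemma 2, and the proof of Theorem 1: "`B_T^x ≤ (x/x_c)^T B_T^{x_c}`", "`B_1 > 0`").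

**The width-two strip is a ladder.** The vertices of `S_{2,L}` are the level-`0…3` vertices; levels `0/1`
form one zig-zag rail and levels `2/3` another (position `p = 2x₀ + bit + x₁` along each), joined by the
rungs of `ℍ` at the ODD positions; `α` exits hang below the even bottom positions (`a` is the one at `0`),
`β` exits above the even top positions (§1). A self-avoiding walk from `a` crosses each cut between
consecutive positions at most twice, which yields the following FAMILY of walks (§3): an optional rigid
LEFT EXCURSION (bottom rail out to `−(2k+1)`, the rung, top rail back to `0`), a monotone WEAVE over the
position pairs `(2i−1, 2i)` switching rails freely at the odd positions (word `l ∈ {⊥,⊤}^j`), an optional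
rigid RIGHT EXCURSION (out on the arrival rail to `2j + 2k'+1`, the rung, back to `2j`), and the exit from
the final rail — through `β` if it is the top rail, through `α` if it is the bottom rail; plus the walks
exiting through `β` straight above `a` after one excursion. We do NOT prove in this file that the family
exhausts the self-avoiding walks of the strip (it does): we prove that its members are distinct
self-avoiding mid-edge walks of `S_{2,2N}` with the stated exits (§2–§5, §7), so that their generating
sums are LOWER bounds for `B_{2,2N}(x)` and `A_{2,2N}(x)` (§7), we evaluate the sums in closed form by the
`2 × 2` weave transfer matrix `[[x², x³],[x³, x²]]` and two geometric excursion series (§6, §8):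
`B₂(x) ≥ 2x[S_O(1+R²) + 2R·S_E + R]`, `A₂(x) ≥ 2x[S_E(1+R²) + 2R·S_O]`, `R = x³/(1−x⁴)`,
`S_{E/O} = ½[a/(1−a) ± b/(1−b)]`, `a = x²+x³`, `b = x²−x³` — as rational functions
`P_B/Q`, `P_A/Q` with `Q = (1−x⁴)²(1−x²−x³)(1−x²+x³)` (the strip's own critical point is the root of
`1 − x² − x³`, the inverse plastic number) —, and we close BOTH evaluations with the tree's strip identity
`cos(3π/8)·A₂ + B₂ = 1`: at `x = x_c` (`x_c² = (2−√2)/2`, `1 − 4x_c² + 2x_c⁴ = 0`, `cos(3π/8)·x_c = (√2−1)/2`)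
the two lower bounds ALREADY add up to `1` (§9: `49·P_B − (54−60x²)·Q` and `49·P_A/(2x) − (45−50x²)·Q` are
multiples of `1 − 4x² + 2x⁴`), so each is attained (§10). Completeness of the family at `x_c` is thereby
certified by Lemma 2 rather than assumed.

## Main statements (namespace `Literature.Probability.RandomPlanarGeometry.SAW.HV`)

* `HV.stripBlim_two_eq : stripBlim 2 = (30 * Real.sqrt 2 - 6) / 49` (`= 0.743396…`, minimal polynomial
  `49B² + 12B − 36`);
* `HV.stripAlim_two_eq : stripAlim 2 = hexCriticalFugacity * (50 * Real.sqrt 2 - 10) / 49`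
  (`= 5√(2+√2)(11√2−12)/49 = 0.670538…`);
* for every subcritical fugacity `0 ≤ x < 1`, `x² + x³ < 1`: `W2.limB_le_of_stripB_le` / `W2.limA_le_of_stripA_le`
  (the family sums `P_B(x)/Q(x)`, `P_A(x)/Q(x)` are below every common upper bound of the `B_{2,L}(x)`,
  `A_{2,L}(x)`), with the rational forms `W2.limB_eq_div`, `W2.limA_eq_div`;
* the machinery in `HV.W2`: the ladder coordinates `lad`/`LAdj`, the generic `walkOfA_mem` (an abstract
  ladder chain without repetition is a mid-edge walk of `S_{2,L}`), the families `encode`/`famWalk` with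
  `famWalk_mem`, `famWalk_inj`, the parameter sets `paramsB`/`paramsA` with the closed partial sums
  `sum_paramsB`/`sum_paramsA`, the bounds `sum_paramsB_le_stripB`/`sum_paramsA_le_stripA`, the weave transfer
  closed form `wsum_eq`, the limits `tendsto_sum_paramsB`/`tendsto_sum_paramsA`, and the algebra at `x_c`
  (`sqrt_two_eq`, `minpoly_xc`, `cos_mul_xc`, `limB_xc`, `EA_xc`).

Printed status (lane «pcv-sawmu» route R54 (ii); literature cell lit-2 g11, 2026-08-22). The exact rational
generating functions of this strip, `B(z) = 2z⁴(2−4z⁴+2z⁶+2z⁸−z¹⁰)/((1−z⁴)²(1−2z²+z⁴−z⁶))` and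
`A(z) = 2z³(1−z²+z⁴+3z⁶−4z⁸+z¹²)/((1−z⁴)²(1−2z²+z⁴−z⁶))`, were REPORTED — as transfer-matrix enumeration
output, without proof — by N. R. Beaton, A. J. Guttmann, I. Jensen, *A numerical adaptation of self-avoiding
walk identities from the honeycomb to other 2D lattices*, J. Phys. A 45 (2012) 035201 (arXiv:1110.1141), §2
(their strip "width 1" is width 2 here; their `B_0(z) = 2z²/(1−z²)` is the tree's width one). Substituting
`z = x_c` in their `B`, `A` gives exactly the values proved here, which themselves are not printed. So:
the generating functions are in print unproved; this file gives a proof-grade evaluation at `x_c` (kernel,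
standard axioms) by explicit walk families and the Duminil-Copin–Smirnov strip identity, with no
transfer-matrix completeness step; our closed forms `P_B/Q`, `P_A/Q` coincide with the printed ones
(`W2.limB_eq_div`, `W2.limA_eq_div`; lower bounds for all subcritical `x`, equalities at `x_c`). The value
also agrees with two independent exact computations of the lane and with certified rational windows to
`L = 120`. The width-one value `B₁(x_c) = 2√2 − 2` is `HexSAWStripWidthOne.lean`.
[cite: BeatonGuttmannJensen2012, §2 (the rational A_1(z), B_1(z) of the honeycomb strip; their width 1 = width 2 here)]
-/

noncomputable section

open Finset Filter Topology

namespace Literature.Probability.RandomPlanarGeometry.SAW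

namespace HV

namespace W2

/-! ### §1. The width-two strip is a ladder: rails, positions, rungs -/

/-- The ladder vertex on rail `r` (`false` = levels `0/1`, `true` = levels `2/3`) at position `p`:
bottom `p ↦ (⌊p/2⌋, 0, p odd)`, top `p ↦ (⌊p/2⌋ − [p even], 1, p even)`; consecutive positions on a rail are
adjacent, and the rungs of `ℍ` join the two rails at the ODD positions. [cite: DuminilCopinSmirnov2012, §3 (Fig. 3, the strip S_{T,L})] -/
def lad (r : Bool) (p : ℤ) : HV :=
  if r then (if p % 2 = 0 then (p / 2 - 1, 1, true) else (p / 2, 1, false))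
  else (if p % 2 = 0 then (p / 2, 0, false) else (p / 2, 0, true))

/-- The ladder vertex of an abstract (rail, position) pair. [cite: DuminilCopinSmirnov2012, §3 (Fig. 3)] -/
def ladV (a : Bool × ℤ) : HV := lad a.1 a.2

/-- The position of a vertex of the width-two strip: `2x₀ + bit + x₁`. [cite: DuminilCopinSmirnov2012, §3 (Fig. 3)] -/
def lpos (v : HV) : ℤ := 2 * v.1 + bit v + v.2.1

/-- `lpos (lad r p) = p`. [cite: DuminilCopinSmirnov2012, §3 (Fig. 3)] -/
theorem lpos_lad (r : Bool) (p : ℤ) : lpos (lad r p) = p := by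
  unfold lad lpos
  cases r <;> split_ifs with h <;> simp [bit] <;> omega

/-- The second coordinate of `lad r p` is the rail. [cite: DuminilCopinSmirnov2012, §3 (Fig. 3)] -/
theorem lad_snd_fst (r : Bool) (p : ℤ) : (lad r p).2.1 = if r then 1 else 0 := by
  unfold lad
  cases r <;> split_ifs <;> simp

/-- `ladV` is injective. [cite: DuminilCopinSmirnov2012, §3 (Fig. 3)] -/
theorem ladV_injective : Function.Injective ladV := by
  rintro ⟨r, p⟩ ⟨r', q⟩ h
  have h1 := congrArg lpos h
  have h2 := congrArg (fun v : HV => v.2.1) h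
  simp only [ladV, lpos_lad, lad_snd_fst] at h1 h2
  have hr : r = r' := by
    cases r <;> cases r' <;> simp at h2 ⊢
  subst hr; subst h1; rfl

/-- Consecutive positions on a rail are adjacent. [cite: DuminilCopinSmirnov2012, §3 (Fig. 3)] -/
theorem adj_lad_succ (r : Bool) (p : ℤ) : hvGraph.Adj (lad r p) (lad r (p + 1)) := by
  rw [hvGraph_adj]
  unfold lad AdjRel
  rcases Int.emod_two_eq_zero_or_one p with h | h
  · have h' : (p + 1) % 2 = 1 := by omega
    have hd : (p + 1) / 2 = p / 2 := by omega
    cases r <;> simp [h, h', hd]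
  · have h' : (p + 1) % 2 = 0 := by omega
    have hd : (p + 1) / 2 = p / 2 + 1 := by omega
    cases r <;> simp [h, h', hd]

/-- … in both directions. [cite: DuminilCopinSmirnov2012, §3 (Fig. 3)] -/
theorem adj_lad_pred (r : Bool) (p : ℤ) : hvGraph.Adj (lad r p) (lad r (p - 1)) := by
  have := adj_lad_succ r (p - 1)
  rw [sub_add_cancel] at this
  exact this.symm

/-- The rung at an odd position joins the two rails. [cite: DuminilCopinSmirnov2012, §3 (Fig. 3)] -/
theorem adj_lad_rung {p : ℤ} (hp : p % 2 = 1) (r : Bool) : hvGraph.Adj (lad r p) (lad (!r) p) := by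
  rw [hvGraph_adj]
  unfold lad AdjRel
  cases r <;> simp [hp]

/-- The `β` exit above the top vertex at an even position. [cite: DuminilCopinSmirnov2012, §3 (β)] -/
theorem adj_lad_beta {q : ℤ} (hq : q % 2 = 0) : hvGraph.Adj (lad true q) (q / 2 - 1, 2, false) := by
  rw [hvGraph_adj]
  unfold lad AdjRel
  simp [hq]

/-- The `α` exit below the bottom vertex at an even position. [cite: DuminilCopinSmirnov2012, §3 (α)] -/
theorem adj_lad_alpha {p : ℤ} (hp : p % 2 = 0) : hvGraph.Adj (lad false p) (p / 2, -1, true) := by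
  rw [hvGraph_adj]
  unfold lad AdjRel
  simp [hp]

/-- Ladder vertices with `|p| ≤ 2L` lie in `S_{2,L}`. [cite: DuminilCopinSmirnov2012, §3 (the strip S_{T,L})] -/
theorem lad_mem_stripV {L : ℕ} {p : ℤ} (hp : |p| ≤ 2 * (L : ℤ)) (r : Bool) : lad r p ∈ stripV 2 L := by
  rw [mem_stripV_iff]
  rw [abs_le] at hp
  unfold lad
  rcases Int.emod_two_eq_zero_or_one p with h | h <;> cases r <;> simp [h, bit] <;> omega

/-- `lad false 0 = O`. [cite: DuminilCopinSmirnov2012, §3 (the strip S_{T,L})] -/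
@[simp] theorem lad_false_zero : lad false 0 = hvOrigin := by
  unfold lad; simp; rfl

/-- Abstract adjacency on the ladder: a rail step `±1`, or a rung at an odd position.
[cite: DuminilCopinSmirnov2012, §3 (Fig. 3)] -/
def LAdj (a b : Bool × ℤ) : Prop :=
  (a.1 = b.1 ∧ (b.2 = a.2 + 1 ∨ b.2 = a.2 - 1)) ∨ (b.1 = !a.1 ∧ b.2 = a.2 ∧ a.2 % 2 = 1)

/-- Abstract adjacency is honeycomb adjacency. [cite: DuminilCopinSmirnov2012, §3 (Fig. 3)] -/
theorem LAdj.adj {a b : Bool × ℤ} (h : LAdj a b) : hvGraph.Adj (ladV a) (ladV b) := by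
  obtain ⟨r, p⟩ := a
  obtain ⟨r', q⟩ := b
  simp only [LAdj] at h
  simp only [ladV]
  rcases h with ⟨hr, hq | hq⟩ | ⟨hr, hq, hp⟩
  · subst hr; subst hq; exact adj_lad_succ r p
  · subst hr; subst hq; exact adj_lad_pred r p
  · subst hr; subst hq; exact adj_lad_rung hp r

/-! ### §2. Mid-edge walks of `S_{2,L}` from abstract ladder lists -/

/-- The exit vertex after the last ladder vertex `(f, e)` (`e` even): up through `β` from the top rail,
down through `α` from the bottom rail. [cite: DuminilCopinSmirnov2012, §3 (α, β)] -/
def exitOf (f : Bool) (e : ℤ) : HV := if f then (e / 2 - 1, 2, false) else (e / 2, -1, true)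

/-- The mid-edge walk list of an abstract ladder list `A` ending at `(f, e)`: `w`, the ladder vertices, the exit.
[cite: DuminilCopinSmirnov2012, §3] -/
def walkOfA (A : List (Bool × ℤ)) (f : Bool) (e : ℤ) : List HV := wOut :: (A.map ladV ++ [exitOf f e])

/-- `ℓ` of the walk of an abstract list is its length. [cite: DuminilCopinSmirnov2012, §1] -/
theorem mwLen_walkOfA (A : List (Bool × ℤ)) (f : Bool) (e : ℤ) : mwLen (walkOfA A f e) = A.length := by
  simp [mwLen, walkOfA]

/-- The final dart of the walk of an abstract list ending at `(f,e)`. [cite: DuminilCopinSmirnov2012, §1] -/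
theorem finalDart_walkOfA {A : List (Bool × ℤ)} {f : Bool} {e : ℤ} (hlast : A.getLast? = some (f, e)) :
    finalDart (walkOfA A f e) = (lad f e, exitOf f e) := by
  rw [finalDart, walkOfA]
  have h1 : (wOut :: (A.map ladV ++ [exitOf f e])).getLast? = some (exitOf f e) := by
    rw [← List.cons_append, List.getLast?_concat]
  have hne : A ≠ [] := by rintro rfl; simp at hlast
  obtain ⟨ys, hys⟩ := List.getLast?_eq_some_iff.1 hlast
  have h2 : (wOut :: A.map ladV).getLast? = some (lad f e) := by
    rw [hys, List.map_append, List.map_singleton, ← List.cons_append, List.getLast?_concat]; rfl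
  rw [h1, List.dropLast_cons_of_ne_nil (by simp), List.dropLast_concat, h2]
  rfl

/-- **An abstract ladder list gives a self-avoiding mid-edge walk of `S_{2,L}`**: if `A` starts at `(false, 0)`
(the origin), is an `LAdj`-chain without repetition, has positions `|p| ≤ 2L`, and ends at `(f, e)` with `e` even
(and `e ≠ 0` if `f = false`), then `walkOfA A f e` is a mid-edge walk of `S_{2,L}` exiting through `β` (top rail)
or `α` (bottom rail). [cite: DuminilCopinSmirnov2012, §3 (S_{T,L}, α, β)] -/
theorem walkOfA_mem {A : List (Bool × ℤ)} {L : ℕ} {f : Bool} {e : ℤ}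
    (hA0 : A.head? = some (false, 0)) (hch : A.IsChain LAdj) (hnd : A.Nodup)
    (hbd : ∀ a ∈ A, |a.2| ≤ 2 * (L : ℤ)) (hlast : A.getLast? = some (f, e)) (he : e % 2 = 0)
    (hfe : f = false → e ≠ 0) :
    walkOfA A f e ∈ midWalks (stripV 2 L) := by
  have hne : A ≠ [] := by rintro rfl; simp at hlast
  set u := exitOf f e with hu
  have hhead : (A.map ladV ++ [u]).head? = some hvOrigin := by
    obtain ⟨a, A', rfl⟩ := List.exists_cons_of_ne_nil hne
    simp only [List.head?_cons, Option.some.injEq] at hA0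
    subst hA0
    simp [ladV]
  have hlastv : (A.map ladV).getLast? = some (lad f e) := by
    rw [List.getLast?_map, hlast]; rfl
  rw [mem_midWalks_iff]
  refine ⟨?_, rfl, hhead, ?_, ?_, ?_⟩
  · -- chain
    rw [walkOfA, List.isChain_cons]
    refine ⟨fun y hy => ?_, ?_⟩
    · rw [hhead] at hy
      simp only [Option.mem_def, Option.some.injEq] at hy
      subst hy
      exact adj_wOut_hvOrigin
    · rw [List.isChain_append]
      refine ⟨(List.isChain_map ladV).2 (hch.imp fun a b h => h.adj), List.isChain_singleton _,
        fun x hx y hy => ?_⟩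
      rw [hlastv] at hx
      simp only [Option.mem_def, Option.some.injEq, List.head?_cons] at hx hy
      subst hx; subst hy
      cases f
      · simpa [exitOf] using adj_lad_alpha he
      · simpa [exitOf] using adj_lad_beta he
  · -- inner vertices in the strip
    intro x hx
    rw [walkOfA, inner_cons, List.dropLast_concat, List.mem_map] at hx
    obtain ⟨a, ha, rfl⟩ := hx
    exact lad_mem_stripV (hbd a ha) a.1
  · -- nodup
    rw [walkOfA, inner_cons, List.dropLast_concat]
    exact hnd.map ladV_injective
  · -- the final half-edge does not retrace
    rw [walkOfA]
    intro h
    have h1 : (wOut :: (A.map ladV ++ [u])).getLast? = some u := by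
      rw [← List.cons_append, List.getLast?_concat]
    rw [h1, List.dropLast_cons_of_ne_nil (by simp), List.dropLast_concat] at h
    have hmem : u ∈ (wOut :: A.map ladV).dropLast := List.mem_of_mem_getLast? h
    have hmem' : u ∈ wOut :: A.map ladV := List.mem_of_mem_dropLast hmem
    rcases List.mem_cons.1 hmem' with h2 | h2
    · -- `u = w`: the exit is `β` (second coordinate 2) or `α` at `e ≠ 0`
      rw [hu, exitOf] at h2
      cases f
      · simp only [Bool.false_eq_true, ↓reduceIte, wOut, Prod.mk.injEq] at h2
        have := hfe rfl
        omega
      · simp [wOut] at h2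
    · obtain ⟨a, -, ha⟩ := List.mem_map.1 h2
      have h3 := congrArg (fun v : HV => v.2.1) ha
      simp only [ladV, lad_snd_fst, hu, exitOf] at h3
      cases f <;> simp at h3 <;> split_ifs at h3 <;> omega


/-! ### §3. The walk families: left excursion, weave, right excursion -/

/-- A chain criterion for `(List.range n).map g`. [folklore] -/
private theorem isChain_map_range {α : Type*} {R : α → α → Prop} {g : ℕ → α} {n : ℕ}
    (h : ∀ i : ℕ, i + 1 < n → R (g i) (g (i + 1))) : ((List.range n).map g).IsChain R := by
  rw [List.isChain_iff_getElem]
  intro i hi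
  simp only [List.length_map, List.length_range] at hi
  simp only [List.getElem_map, List.getElem_range]
  exact h i hi

/-- **Left excursion** of depth `m = 2k+1`: from the origin along the bottom rail to position `−m`, the rung
at `−m`, and back along the top rail to position `0`. [cite: DuminilCopinSmirnov2012, §3 (Fig. 3)] -/
def excL (k : ℕ) : List (Bool × ℤ) :=
  (List.range (2 * k + 1)).map (fun i : ℕ => (false, -((i : ℤ) + 1))) ++
    (List.range (2 * k + 2)).map (fun i : ℕ => (true, (i : ℤ) - (2 * k + 1)))

/-- One **weave block** over the positions `p+1, p+2`: enter `p+1` on rail `r`, optionally take the rung at `p+1`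
to rail `b`, advance to `p+2` on rail `b`. [cite: DuminilCopinSmirnov2012, §3 (Fig. 3)] -/
def block (r b : Bool) (p : ℤ) : List (Bool × ℤ) :=
  if b = r then [(r, p + 1), (r, p + 2)] else [(r, p + 1), (b, p + 1), (b, p + 2)]

/-- The **weave** from position `p` on rail `r` along the block word `l`. [cite: DuminilCopinSmirnov2012, §3 (Fig. 3)] -/
def weave : Bool → ℤ → List Bool → List (Bool × ℤ)
  | _, _, [] => []
  | r, p, b :: l => block r b p ++ weave b (p + 2) l

/-- The rail at the end of a weave. [cite: DuminilCopinSmirnov2012, §3 (Fig. 3)] -/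
def wend : Bool → List Bool → Bool
  | r, [] => r
  | _, b :: l => wend b l

/-- The number of vertices of a weave. [cite: DuminilCopinSmirnov2012, §3 (Fig. 3)] -/
def wlen : Bool → List Bool → ℕ
  | _, [] => 0
  | r, b :: l => (if b = r then 2 else 3) + wlen b l

/-- **Right excursion** of depth `m' = 2k+1` from `(c, e)`: out along rail `c` to `e + m'`, the rung, and back
along the other rail to position `e`. [cite: DuminilCopinSmirnov2012, §3 (Fig. 3)] -/
def excR (c : Bool) (e : ℤ) (k : ℕ) : List (Bool × ℤ) :=
  (List.range (2 * k + 1)).map (fun i : ℕ => (c, e + 1 + i)) ++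
    (List.range (2 * k + 2)).map (fun i : ℕ => (!c, e + (2 * k + 1) - i))

/-- The prefix: the origin and the optional left excursion. [cite: DuminilCopinSmirnov2012, §3 (Fig. 3)] -/
def pre (left : Option ℕ) : List (Bool × ℤ) := ((false, (0 : ℤ)) :: left.elim [] excL)

/-- **The encoded walk** (normalised to the right side): origin, optional left excursion, weave along `l`,
optional right excursion. [cite: DuminilCopinSmirnov2012, §3 (Fig. 3)] -/
def encode (left : Option ℕ) (l : List Bool) (right : Option ℕ) : List (Bool × ℤ) :=
  pre left ++ weave left.isSome 0 l ++ right.elim [] (excR (wend left.isSome l) (2 * (l.length : ℤ)))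

/-- The final rail of an encoded walk. [cite: DuminilCopinSmirnov2012, §3 (Fig. 3)] -/
def frail (left : Option ℕ) (l : List Bool) (right : Option ℕ) : Bool :=
  if right.isSome then !(wend left.isSome l) else wend left.isSome l

/-- The length of an encoded walk. [cite: DuminilCopinSmirnov2012, §3 (Fig. 3)] -/
def elen (left : Option ℕ) (l : List Bool) (right : Option ℕ) : ℕ :=
  1 + left.elim 0 (fun k => 4 * k + 3) + wlen left.isSome l + right.elim 0 (fun k => 4 * k + 3)

/-! #### Lengths, heads and last entries -/

/-- The left excursion of depth `2k+1` has `4k+3` vertices. [cite: DuminilCopinSmirnov2012, §3 (Fig. 3)] -/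
@[simp] theorem length_excL (k : ℕ) : (excL k).length = 4 * k + 3 := by
  simp [excL]; ring

/-- The right excursion of depth `2k+1` has `4k+3` vertices. [cite: DuminilCopinSmirnov2012, §3 (Fig. 3)] -/
@[simp] theorem length_excR (c : Bool) (e : ℤ) (k : ℕ) : (excR c e k).length = 4 * k + 3 := by
  simp [excR]; ring

/-- A block has `2` or `3` vertices. [cite: DuminilCopinSmirnov2012, §3 (Fig. 3)] -/
theorem length_block (r b : Bool) (p : ℤ) : (block r b p).length = if b = r then 2 else 3 := by
  unfold block; split_ifs <;> rfl

/-- The weave has `wlen` vertices. [cite: DuminilCopinSmirnov2012, §3 (Fig. 3)] -/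
theorem length_weave (r : Bool) (p : ℤ) (l : List Bool) : (weave r p l).length = wlen r l := by
  induction l generalizing r p with
  | nil => rfl
  | cons b l ih => simp [weave, wlen, length_block, ih]

/-- Length of the prefix. [cite: DuminilCopinSmirnov2012, §3 (Fig. 3)] -/
theorem length_pre (left : Option ℕ) : (pre left).length = 1 + left.elim 0 (fun k => 4 * k + 3) := by
  cases left <;> simp [pre, add_comm]

/-- Length of an encoded walk. [cite: DuminilCopinSmirnov2012, §3 (Fig. 3)] -/
theorem length_encode (left : Option ℕ) (l : List Bool) (right : Option ℕ) :
    (encode left l right).length = elen left l right := by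
  cases right <;> simp [encode, elen, length_pre, length_weave, add_assoc]

/-- The left excursion is nonempty. [cite: DuminilCopinSmirnov2012, §3 (Fig. 3)] -/
theorem excL_ne_nil (k : ℕ) : excL k ≠ [] := by
  intro h; have := congrArg List.length h; simp at this

/-- The left excursion starts at `(false, -1)`. [cite: DuminilCopinSmirnov2012, §3 (Fig. 3)] -/
theorem head?_excL (k : ℕ) : (excL k).head? = some (false, -1) := by
  rw [excL, List.head?_append, List.head?_map, List.head?_range, if_neg (by omega)]
  rfl

/-- The left excursion ends at `(true, 0)`. [cite: DuminilCopinSmirnov2012, §3 (Fig. 3)] -/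
theorem getLast?_excL (k : ℕ) : (excL k).getLast? = some (true, 0) := by
  rw [excL, List.getLast?_append, List.getLast?_map,
    List.getLast?_eq_getElem?, List.length_range, List.getElem?_range (by omega)]
  simp only [Option.map_some, Option.some_or]
  congr 1
  simp only [Prod.mk.injEq, true_and]
  push_cast; ring

/-- The right excursion starts at `(c, e+1)`. [cite: DuminilCopinSmirnov2012, §3 (Fig. 3)] -/
theorem head?_excR (c : Bool) (e : ℤ) (k : ℕ) : (excR c e k).head? = some (c, e + 1) := by
  rw [excR, List.head?_append, List.head?_map, List.head?_range, if_neg (by omega)]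
  simp

/-- The right excursion ends at `(!c, e)`. [cite: DuminilCopinSmirnov2012, §3 (Fig. 3)] -/
theorem getLast?_excR (c : Bool) (e : ℤ) (k : ℕ) : (excR c e k).getLast? = some (!c, e) := by
  rw [excR, List.getLast?_append, List.getLast?_map,
    List.getLast?_eq_getElem?, List.length_range, List.getElem?_range (by omega)]
  simp only [Option.map_some, Option.some_or]
  congr 1
  simp only [Prod.mk.injEq, true_and]
  push_cast; ring

/-- A block starts at `(r, p+1)`. [cite: DuminilCopinSmirnov2012, §3 (Fig. 3)] -/
theorem head?_block (r b : Bool) (p : ℤ) : (block r b p).head? = some (r, p + 1) := by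
  unfold block; split_ifs <;> rfl

/-- A block ends at `(b, p+2)`. [cite: DuminilCopinSmirnov2012, §3 (Fig. 3)] -/
theorem getLast?_block (r b : Bool) (p : ℤ) : (block r b p).getLast? = some (b, p + 2) := by
  unfold block; split_ifs with h
  · subst h; rfl
  · rfl

/-- A block is nonempty. [cite: DuminilCopinSmirnov2012, §3 (Fig. 3)] -/
theorem block_ne_nil (r b : Bool) (p : ℤ) : block r b p ≠ [] := by
  unfold block; split_ifs <;> simp

/-- A nonempty weave starts at `(r, p+1)`. [cite: DuminilCopinSmirnov2012, §3 (Fig. 3)] -/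
theorem head?_weave (r b : Bool) (p : ℤ) (l : List Bool) : (weave r p (b :: l)).head? = some (r, p + 1) := by
  rw [weave, List.head?_append, head?_block]; rfl

/-- A nonempty weave ends at `(wend, p + 2|l|)`. [cite: DuminilCopinSmirnov2012, §3 (Fig. 3)] -/
theorem getLast?_weave {l : List Bool} (hl : l ≠ []) (r : Bool) (p : ℤ) :
    (weave r p l).getLast? = some (wend r l, p + 2 * (l.length : ℤ)) := by
  induction l generalizing r p with
  | nil => exact absurd rfl hl
  | cons b l ih =>
    rw [weave, List.getLast?_append]
    rcases eq_or_ne l [] with rfl | hl'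
    · simp only [weave, List.getLast?_nil, Option.none_or, getLast?_block, wend, List.length_singleton]
      push_cast; ring_nf
    · rw [ih hl' b (p + 2)]
      simp only [Option.some_or, wend, List.length_cons]
      push_cast; ring_nf

/-- The prefix ends at `(left.isSome, 0)`. [cite: DuminilCopinSmirnov2012, §3 (Fig. 3)] -/
theorem getLast?_pre (left : Option ℕ) : (pre left).getLast? = some (left.isSome, 0) := by
  cases left with
  | none => rfl
  | some k => rw [pre, Option.elim_some, List.getLast?_cons_of_ne_nil (excL_ne_nil k), getLast?_excL]; rfl

/-- Prefix and weave end at `(wend, 2|l|)`. [cite: DuminilCopinSmirnov2012, §3 (Fig. 3)] -/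
theorem getLast?_pre_weave (left : Option ℕ) (l : List Bool) :
    (pre left ++ weave left.isSome 0 l).getLast? = some (wend left.isSome l, 2 * (l.length : ℤ)) := by
  rcases eq_or_ne l [] with rfl | hl
  · simp [weave, getLast?_pre, wend]
  · rw [List.getLast?_append, getLast?_weave hl]; simp

/-- An encoded walk ends at `(frail, 2|l|)`. [cite: DuminilCopinSmirnov2012, §3 (Fig. 3)] -/
theorem getLast?_encode (left : Option ℕ) (l : List Bool) (right : Option ℕ) :
    (encode left l right).getLast? = some (frail left l right, 2 * (l.length : ℤ)) := by
  cases right with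
  | none => simpa [encode, frail] using getLast?_pre_weave left l
  | some k =>
    simp only [encode, frail, Option.elim_some, Option.isSome_some, if_true]
    rw [List.getLast?_append, getLast?_excR]; simp

/-- An encoded walk starts at the origin `(false, 0)`. [cite: DuminilCopinSmirnov2012, §3 (Fig. 3)] -/
theorem head?_encode (left : Option ℕ) (l : List Bool) (right : Option ℕ) :
    (encode left l right).head? = some (false, 0) := by
  simp [encode, pre]

/-! #### Chains -/

/-- The left excursion is a ladder chain. [cite: DuminilCopinSmirnov2012, §3 (Fig. 3)] -/
theorem isChain_excL (k : ℕ) : (excL k).IsChain LAdj := by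
  rw [excL, List.isChain_append]
  refine ⟨isChain_map_range fun i _ => ?_, isChain_map_range fun i _ => ?_, fun x hx y hy => ?_⟩
  · left; exact ⟨rfl, Or.inr (by push_cast; ring)⟩
  · left; exact ⟨rfl, Or.inl (by push_cast; ring)⟩
  · rw [List.getLast?_map, List.getLast?_eq_getElem?, List.length_range,
      List.getElem?_range (by omega)] at hx
    rw [List.head?_map, List.head?_range, if_neg (by omega)] at hy
    simp only [Option.map_some, Option.mem_def, Option.some.injEq] at hx hy
    subst hx; subst hy
    right
    simp only [Nat.add_sub_cancel, Bool.not_false]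
    refine ⟨by simp, by push_cast; ring, ?_⟩
    push_cast; omega

/-- A block at an even position is a ladder chain (its rung is at the odd position `p+1`).
[cite: DuminilCopinSmirnov2012, §3 (Fig. 3)] -/
theorem isChain_block {p : ℤ} (hp : p % 2 = 0) (r b : Bool) : (block r b p).IsChain LAdj := by
  unfold block
  split_ifs with h
  · simp only [List.isChain_cons_cons, List.isChain_singleton, and_true]
    left; exact ⟨rfl, Or.inl (by ring)⟩
  · have hb : b = !r := by cases b <;> cases r <;> simp_all
    subst hb
    simp only [List.isChain_cons_cons, List.isChain_singleton, and_true]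
    exact ⟨Or.inr ⟨rfl, rfl, by omega⟩, Or.inl ⟨rfl, Or.inl (by ring)⟩⟩

/-- The weave from an even position is a ladder chain. [cite: DuminilCopinSmirnov2012, §3 (Fig. 3)] -/
theorem isChain_weave {p : ℤ} (hp : p % 2 = 0) (r : Bool) (l : List Bool) : (weave r p l).IsChain LAdj := by
  induction l generalizing r p with
  | nil => exact List.IsChain.nil
  | cons b l ih =>
    rw [weave, List.isChain_append]
    refine ⟨isChain_block hp r b, ih (p := p + 2) (by omega) b, fun x hx y hy => ?_⟩
    rw [getLast?_block] at hx
    cases l with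
    | nil => simp [weave] at hy
    | cons b' l' =>
      rw [head?_weave] at hy
      simp only [Option.mem_def, Option.some.injEq] at hx hy
      subst hx; subst hy
      left; exact ⟨rfl, Or.inl (by ring)⟩

/-- The right excursion from an even position is a ladder chain. [cite: DuminilCopinSmirnov2012, §3 (Fig. 3)] -/
theorem isChain_excR {e : ℤ} (he : e % 2 = 0) (c : Bool) (k : ℕ) : (excR c e k).IsChain LAdj := by
  rw [excR, List.isChain_append]
  refine ⟨isChain_map_range fun i _ => ?_, isChain_map_range fun i _ => ?_, fun x hx y hy => ?_⟩
  · left; exact ⟨rfl, Or.inl (by push_cast; ring)⟩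
  · left; exact ⟨rfl, Or.inr (by push_cast; ring)⟩
  · rw [List.getLast?_map, List.getLast?_eq_getElem?, List.length_range,
      List.getElem?_range (by omega)] at hx
    rw [List.head?_map, List.head?_range, if_neg (by omega)] at hy
    simp only [Option.map_some, Option.mem_def, Option.some.injEq] at hx hy
    subst hx; subst hy
    right
    simp only [Nat.add_sub_cancel]
    refine ⟨by simp, by push_cast; ring, ?_⟩
    push_cast; omega

/-- The prefix is a ladder chain. [cite: DuminilCopinSmirnov2012, §3 (Fig. 3)] -/
theorem isChain_pre (left : Option ℕ) : (pre left).IsChain LAdj := by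
  cases left with
  | none => exact List.isChain_singleton _
  | some k =>
    rw [pre, Option.elim_some, List.isChain_cons]
    refine ⟨fun y hy => ?_, isChain_excL k⟩
    rw [head?_excL] at hy
    simp only [Option.mem_def, Option.some.injEq] at hy
    subst hy
    left; exact ⟨rfl, Or.inr (by norm_num)⟩

/-- Prefix and weave form a ladder chain. [cite: DuminilCopinSmirnov2012, §3 (Fig. 3)] -/
theorem isChain_pre_weave (left : Option ℕ) (l : List Bool) :
    (pre left ++ weave left.isSome 0 l).IsChain LAdj := by
  rw [List.isChain_append]
  refine ⟨isChain_pre left, isChain_weave (by norm_num) _ l, fun x hx y hy => ?_⟩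
  rw [getLast?_pre] at hx
  cases l with
  | nil => simp [weave] at hy
  | cons b l' =>
    rw [head?_weave] at hy
    simp only [Option.mem_def, Option.some.injEq] at hx hy
    subst hx; subst hy
    left; exact ⟨rfl, Or.inl (by ring)⟩

/-- An encoded walk is a ladder chain. [cite: DuminilCopinSmirnov2012, §3 (Fig. 3)] -/
theorem isChain_encode (left : Option ℕ) (l : List Bool) (right : Option ℕ) :
    (encode left l right).IsChain LAdj := by
  cases right with
  | none => simpa [encode] using isChain_pre_weave left l
  | some k =>
    rw [encode, Option.elim_some, List.isChain_append]
    refine ⟨isChain_pre_weave left l, isChain_excR (by omega) _ k, fun x hx y hy => ?_⟩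
    rw [getLast?_pre_weave] at hx
    rw [head?_excR] at hy
    simp only [Option.mem_def, Option.some.injEq] at hx hy
    subst hx; subst hy
    left; exact ⟨rfl, Or.inl rfl⟩

/-! #### Positions and no repetitions -/

/-- Positions of the left excursion. [cite: DuminilCopinSmirnov2012, §3 (Fig. 3)] -/
theorem mem_excL {k : ℕ} {a : Bool × ℤ} (h : a ∈ excL k) :
    (a.1 = false ∧ -(2 * (k : ℤ) + 1) ≤ a.2 ∧ a.2 ≤ -1) ∨ (a.1 = true ∧ -(2 * (k : ℤ) + 1) ≤ a.2 ∧ a.2 ≤ 0) := by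
  simp only [excL, List.mem_append, List.mem_map, List.mem_range] at h
  rcases h with ⟨i, hi, rfl⟩ | ⟨i, hi, rfl⟩
  · left; refine ⟨rfl, ?_, ?_⟩ <;> push_cast <;> omega
  · right; refine ⟨rfl, ?_, ?_⟩ <;> push_cast <;> omega

/-- The left excursion has no repeated vertex. [cite: DuminilCopinSmirnov2012, §3 (Fig. 3)] -/
theorem nodup_excL (k : ℕ) : (excL k).Nodup := by
  rw [excL, List.nodup_append]
  refine ⟨(List.nodup_range).map fun i j h => ?_, (List.nodup_range).map fun i j h => ?_, ?_⟩
  · simp only [Prod.mk.injEq, true_and] at h; omega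
  · simp only [Prod.mk.injEq, true_and] at h; omega
  · intro a ha b hb hab
    simp only [List.mem_map, List.mem_range] at ha hb
    obtain ⟨i, -, rfl⟩ := ha
    obtain ⟨j, -, rfl⟩ := hb
    simp at hab

/-- Positions of a block. [cite: DuminilCopinSmirnov2012, §3 (Fig. 3)] -/
theorem mem_block {r b : Bool} {p : ℤ} {a : Bool × ℤ} (h : a ∈ block r b p) :
    a.2 = p + 1 ∨ a = (b, p + 2) := by
  unfold block at h
  split_ifs at h with hb
  · subst hb
    simp only [List.mem_cons, List.not_mem_nil, or_false] at h
    rcases h with rfl | rfl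
    · exact Or.inl rfl
    · exact Or.inr rfl
  · simp only [List.mem_cons, List.not_mem_nil, or_false] at h
    rcases h with rfl | rfl | rfl
    · exact Or.inl rfl
    · exact Or.inl rfl
    · exact Or.inr rfl

/-- A block has no repeated vertex. [cite: DuminilCopinSmirnov2012, §3 (Fig. 3)] -/
theorem nodup_block (r b : Bool) (p : ℤ) : (block r b p).Nodup := by
  unfold block
  split_ifs with h
  · simp
  · have hb : r ≠ b := Ne.symm h
    simp [hb]

/-- Positions of the weave: in `[p+1, p+2|l|]`, and the rail at the last position is `wend`.
[cite: DuminilCopinSmirnov2012, §3 (Fig. 3)] -/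
theorem mem_weave {r : Bool} {p : ℤ} {l : List Bool} {a : Bool × ℤ} (h : a ∈ weave r p l) :
    p + 1 ≤ a.2 ∧ a.2 ≤ p + 2 * (l.length : ℤ) ∧ (a.2 = p + 2 * (l.length : ℤ) → a.1 = wend r l) := by
  induction l generalizing r p with
  | nil => simp [weave] at h
  | cons b l ih =>
    rw [weave, List.mem_append] at h
    have hlen : ((b :: l).length : ℤ) = l.length + 1 := by push_cast [List.length_cons]; ring
    rw [hlen]
    rcases h with h | h
    · rcases mem_block h with h1 | rfl
      · refine ⟨by omega, by omega, fun h2 => ?_⟩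
        have : (l.length : ℤ) = 0 := by omega
        have hl : l = [] := List.eq_nil_of_length_eq_zero (by exact_mod_cast this)
        omega
      · refine ⟨by change p + 1 ≤ p + 2; omega, by change p + 2 ≤ _; omega, fun h2 => ?_⟩
        change p + 2 = _ at h2
        have : (l.length : ℤ) = 0 := by omega
        have hl : l = [] := List.eq_nil_of_length_eq_zero (by exact_mod_cast this)
        subst hl; rfl
    · obtain ⟨h1, h2, h3⟩ := ih h
      exact ⟨by omega, by omega, fun h4 => h3 (by omega)⟩

/-- The weave has no repeated vertex. [cite: DuminilCopinSmirnov2012, §3 (Fig. 3)] -/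
theorem nodup_weave (r : Bool) (p : ℤ) (l : List Bool) : (weave r p l).Nodup := by
  induction l generalizing r p with
  | nil => exact List.nodup_nil
  | cons b l ih =>
    rw [weave, List.nodup_append]
    refine ⟨nodup_block r b p, ih b (p + 2), fun a ha c hc hac => ?_⟩
    subst hac
    have h1 := (mem_weave hc).1
    rcases mem_block ha with h2 | rfl
    · omega
    · change p + 2 + 1 ≤ p + 2 at h1; omega

/-- Positions of the right excursion. [cite: DuminilCopinSmirnov2012, §3 (Fig. 3)] -/
theorem mem_excR {c : Bool} {e : ℤ} {k : ℕ} {a : Bool × ℤ} (h : a ∈ excR c e k) :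
    (a.1 = c ∧ e + 1 ≤ a.2 ∧ a.2 ≤ e + (2 * k + 1)) ∨ (a.1 = !c ∧ e ≤ a.2 ∧ a.2 ≤ e + (2 * k + 1)) := by
  simp only [excR, List.mem_append, List.mem_map, List.mem_range] at h
  rcases h with ⟨i, hi, rfl⟩ | ⟨i, hi, rfl⟩
  · left; refine ⟨rfl, ?_, ?_⟩ <;> push_cast <;> omega
  · right; refine ⟨rfl, ?_, ?_⟩ <;> push_cast <;> omega

/-- The right excursion has no repeated vertex. [cite: DuminilCopinSmirnov2012, §3 (Fig. 3)] -/
theorem nodup_excR (c : Bool) (e : ℤ) (k : ℕ) : (excR c e k).Nodup := by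
  rw [excR, List.nodup_append]
  refine ⟨(List.nodup_range).map fun i j h => ?_, (List.nodup_range).map fun i j h => ?_, ?_⟩
  · simp only [Prod.mk.injEq, true_and] at h; omega
  · simp only [Prod.mk.injEq, true_and] at h; omega
  · intro a ha b hb hab
    simp only [List.mem_map, List.mem_range] at ha hb
    obtain ⟨i, -, rfl⟩ := ha
    obtain ⟨j, -, rfl⟩ := hb
    cases c <;> simp at hab

/-- Positions of the prefix are `≤ 0`. [cite: DuminilCopinSmirnov2012, §3 (Fig. 3)] -/
theorem mem_pre {left : Option ℕ} {a : Bool × ℤ} (h : a ∈ pre left) : a.2 ≤ 0 := by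
  cases left with
  | none => simp [pre] at h; subst h; simp
  | some k =>
    simp only [pre, Option.elim_some, List.mem_cons] at h
    rcases h with rfl | h
    · simp
    · rcases mem_excL h with ⟨_, _, h3⟩ | ⟨_, _, h3⟩ <;> omega

/-- The prefix has no repeated vertex. [cite: DuminilCopinSmirnov2012, §3 (Fig. 3)] -/
theorem nodup_pre (left : Option ℕ) : (pre left).Nodup := by
  cases left with
  | none => exact List.nodup_singleton _
  | some k =>
    rw [pre, Option.elim_some, List.nodup_cons]
    refine ⟨fun h => ?_, nodup_excL k⟩
    rcases mem_excL h with ⟨_, _, h3⟩ | ⟨h1, _, _⟩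
    · simp at h3
    · simp at h1

/-- Prefix and weave have no repeated vertex. [cite: DuminilCopinSmirnov2012, §3 (Fig. 3)] -/
theorem nodup_pre_weave (left : Option ℕ) (l : List Bool) : (pre left ++ weave left.isSome 0 l).Nodup := by
  rw [List.nodup_append]
  refine ⟨nodup_pre left, nodup_weave _ 0 l, fun a ha b hb hab => ?_⟩
  subst hab
  have h1 := mem_pre ha
  have h2 := (mem_weave hb).1
  omega

/-- **An encoded walk has no repeated vertex** (for a nonempty weave, or no left excursion).
[cite: DuminilCopinSmirnov2012, §3 (Fig. 3)] -/
theorem nodup_encode {left : Option ℕ} {l : List Bool} (hl : l ≠ [] ∨ left = none) (right : Option ℕ) :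
    (encode left l right).Nodup := by
  cases right with
  | none => simpa [encode] using nodup_pre_weave left l
  | some k =>
    rw [encode, Option.elim_some, List.nodup_append]
    refine ⟨nodup_pre_weave left l, nodup_excR _ _ k, fun a ha b hb hab => ?_⟩
    subst hab
    rw [List.mem_append] at ha
    rcases mem_excR hb with ⟨h3, h4, _⟩ | ⟨h3, h4, h5⟩
    · -- position `≥ 2|l| + 1`: not in the prefix (`≤ 0`) nor the weave (`≤ 2|l|`)
      rcases ha with ha | ha
      · have := mem_pre ha; omega
      · have := (mem_weave ha).2.1; omega
    · rcases ha with ha | ha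
      · have h1 := mem_pre ha
        have h6 : (l.length : ℤ) = 0 := by omega
        have hl0 : l = [] := List.eq_nil_of_length_eq_zero (by exact_mod_cast h6)
        rcases hl with hl | rfl
        · exact hl hl0
        · subst hl0
          simp [pre] at ha
          rw [ha] at h3
          simp [wend] at h3
      · obtain ⟨h1, h2, h6⟩ := mem_weave ha
        have h7 := h6 (by omega)
        rw [h7] at h3
        cases wend left.isSome l <;> simp at h3

/-- All positions of an encoded walk with parameters below `N` are at most `4N` in absolute value.
[cite: DuminilCopinSmirnov2012, §3 (Fig. 3)] -/
theorem abs_le_of_mem_encode {left : Option ℕ} {l : List Bool} {right : Option ℕ} {N : ℕ}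
    (hleft : ∀ k, left = some k → k < N) (hl : l.length ≤ N) (hright : ∀ k, right = some k → k < N)
    {a : Bool × ℤ} (h : a ∈ encode left l right) : |a.2| ≤ 2 * ((2 * N : ℕ) : ℤ) := by
  rw [abs_le]
  push_cast
  have hlN : (l.length : ℤ) ≤ N := by exact_mod_cast hl
  rw [encode, List.mem_append, List.mem_append] at h
  rcases h with (h | h) | h
  · have h1 := mem_pre h
    cases left with
    | none => simp [pre] at h; subst h; constructor <;> simp
    | some k =>
      have hk : (k : ℤ) < N := by exact_mod_cast hleft k rfl
      simp only [pre, Option.elim_some, List.mem_cons] at h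
      rcases h with rfl | h
      · constructor <;> simp
      · rcases mem_excL h with ⟨_, h2, h3⟩ | ⟨_, h2, h3⟩ <;> constructor <;> omega
  · obtain ⟨h1, h2, _⟩ := mem_weave h
    constructor <;> omega
  · cases right with
    | none => simp at h
    | some k =>
      have hk : (k : ℤ) < N := by exact_mod_cast hright k rfl
      rw [Option.elim_some] at h
      rcases mem_excR h with ⟨_, h2, h3⟩ | ⟨_, h2, h3⟩ <;> constructor <;> omega

/-! ### §4. The mirror, the walk of a parameter, membership in `S_{2,L}` -/

/-- The mirror `p ↦ s·p` of the ladder (`s = ±1`; the reflection of `ℍ` fixing `a` for `s = -1`).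
[cite: DuminilCopinSmirnov2012, §3 (Fig. 3)] -/
def smap (s : ℤ) (a : Bool × ℤ) : Bool × ℤ := (a.1, s * a.2)

/-- The mirror keeps the rail. [cite: DuminilCopinSmirnov2012, §3 (Fig. 3)] -/
@[simp] theorem smap_fst (s : ℤ) (a : Bool × ℤ) : (smap s a).1 = a.1 := rfl

/-- The mirror multiplies the position. [cite: DuminilCopinSmirnov2012, §3 (Fig. 3)] -/
@[simp] theorem smap_snd (s : ℤ) (a : Bool × ℤ) : (smap s a).2 = s * a.2 := rfl

/-- The mirror preserves ladder adjacency. [cite: DuminilCopinSmirnov2012, §3 (Fig. 3)] -/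
theorem LAdj.smap {s : ℤ} (hs : s = 1 ∨ s = -1) {a b : Bool × ℤ} (h : LAdj a b) :
    LAdj (smap s a) (smap s b) := by
  simp only [LAdj, smap_fst, smap_snd] at h ⊢
  rcases hs with rfl | rfl
  · simpa using h
  · rcases h with ⟨h1, h2 | h2⟩ | ⟨h1, h2, h3⟩
    · left; exact ⟨h1, Or.inr (by rw [h2]; ring)⟩
    · left; exact ⟨h1, Or.inl (by rw [h2]; ring)⟩
    · right; exact ⟨h1, by rw [h2], by omega⟩

/-- The mirror is injective (`s ≠ 0`). [cite: DuminilCopinSmirnov2012, §3 (Fig. 3)] -/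
theorem smap_injective {s : ℤ} (hs : s ≠ 0) : Function.Injective (smap s) := by
  rintro ⟨r, p⟩ ⟨r', q⟩ h
  simp only [smap, Prod.mk.injEq] at h
  obtain ⟨rfl, h2⟩ := h
  have := mul_left_cancel₀ hs h2
  subst this; rfl

/-- **The walk with parameters `(s, left, l, right)`**: side `s = ±1`, optional left excursion of depth
`2k+1`, weave word `l`, optional right excursion of depth `2k'+1`. [cite: DuminilCopinSmirnov2012, §3 (Fig. 3)] -/
def famWalk (s : ℤ) (left : Option ℕ) (l : List Bool) (right : Option ℕ) : List HV :=
  walkOfA ((encode left l right).map (smap s)) (frail left l right) (s * (2 * (l.length : ℤ)))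

/-- `ℓ` of a family walk. [cite: DuminilCopinSmirnov2012, §1] -/
theorem mwLen_famWalk (s : ℤ) (left : Option ℕ) (l : List Bool) (right : Option ℕ) :
    mwLen (famWalk s left l right) = elen left l right := by
  rw [famWalk, mwLen_walkOfA, List.length_map, length_encode]

/-- The final dart of a family walk. [cite: DuminilCopinSmirnov2012, §1] -/
theorem finalDart_famWalk (s : ℤ) (left : Option ℕ) (l : List Bool) (right : Option ℕ) :
    finalDart (famWalk s left l right) =
      (lad (frail left l right) (s * (2 * (l.length : ℤ))), exitOf (frail left l right) (s * (2 * (l.length : ℤ)))) := by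
  apply finalDart_walkOfA
  rw [List.getLast?_map, getLast?_encode]; rfl

/-- Admissible parameters: a nonempty weave, or no left excursion and a right excursion (the walks exiting
through `β` straight above `a`). [cite: DuminilCopinSmirnov2012, §3 (Fig. 3)] -/
def Adm (left : Option ℕ) (l : List Bool) (right : Option ℕ) : Prop :=
  l ≠ [] ∨ (left = none ∧ right.isSome = true)

/-- With an empty weave an admissible walk ends on the top rail. [cite: DuminilCopinSmirnov2012, §3 (Fig. 3)] -/
theorem Adm.frail_of_nil {left : Option ℕ} {right : Option ℕ} (h : Adm left [] right) : frail left [] right = true := by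
  rcases h with h | ⟨rfl, h⟩
  · exact absurd rfl h
  · simp [frail, h, wend]

/-- **A family walk with admissible parameters below `N` is a self-avoiding mid-edge walk of `S_{2,2N}`.**
[cite: DuminilCopinSmirnov2012, §3 (S_{T,L})] -/
theorem famWalk_mem {s : ℤ} (hs : s = 1 ∨ s = -1) {left : Option ℕ} {l : List Bool} {right : Option ℕ}
    (hadm : Adm left l right) {N : ℕ} (hleft : ∀ k, left = some k → k < N) (hl : l.length ≤ N)
    (hright : ∀ k, right = some k → k < N) : famWalk s left l right ∈ midWalks (stripV 2 (2 * N)) := by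
  have hs0 : s ≠ 0 := by rcases hs with rfl | rfl <;> norm_num
  have hs2 : s * s = 1 := by rcases hs with rfl | rfl <;> norm_num
  apply walkOfA_mem
  · rw [List.head?_map, head?_encode]; simp [smap]
  · exact (List.isChain_map (smap s)).2 ((isChain_encode left l right).imp fun a b h => h.smap hs)
  · exact (nodup_encode (hadm.imp_right fun h => h.1) right).map (smap_injective hs0)
  · intro a ha
    obtain ⟨b, hb, rfl⟩ := List.mem_map.1 ha
    simp only [smap, abs_mul]
    have : |s| = 1 := by rcases hs with rfl | rfl <;> norm_num
    rw [this, one_mul]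
    exact abs_le_of_mem_encode hleft hl hright hb
  · rw [List.getLast?_map, getLast?_encode]; rfl
  · rcases hs with rfl | rfl <;> omega
  · intro hf
    cases l with
    | nil => rw [hadm.frail_of_nil] at hf; exact absurd hf (by decide)
    | cons b l' => exact mul_ne_zero hs0 (mul_ne_zero two_ne_zero (by simp; omega))

/-- A family walk ending on the top rail exits through `β`. [cite: DuminilCopinSmirnov2012, §3 (β)] -/
theorem famWalk_beta {s : ℤ} (hs : s = 1 ∨ s = -1) {left : Option ℕ} {l : List Bool} {right : Option ℕ}
    (hf : frail left l right = true) : IsBetaDart 2 (finalDart (famWalk s left l right)) := by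
  rw [finalDart_famWalk, hf]
  have he : (s * (2 * (l.length : ℤ))) % 2 = 0 := by rcases hs with rfl | rfl <;> omega
  unfold IsBetaDart lad exitOf
  simp [he]

/-- A family walk ending on the bottom rail exits through `α`. [cite: DuminilCopinSmirnov2012, §3 (α)] -/
theorem famWalk_alpha {s : ℤ} (hs : s = 1 ∨ s = -1) {left : Option ℕ} {l : List Bool} {right : Option ℕ}
    (hf : frail left l right = false) : IsAlphaDart (finalDart (famWalk s left l right)) := by
  rw [finalDart_famWalk, hf]
  have he : (s * (2 * (l.length : ℤ))) % 2 = 0 := by rcases hs with rfl | rfl <;> omega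
  unfold IsAlphaDart lad exitOf
  simp [he]

/-! ### §5. Distinct parameters give distinct walks -/

/-- The weave determines its word. [cite: DuminilCopinSmirnov2012, §3 (Fig. 3)] -/
theorem weave_injective (r : Bool) (p : ℤ) : Function.Injective (weave r p) := by
  intro l₁
  induction l₁ generalizing r p with
  | nil =>
    intro l₂ h
    cases l₂ with
    | nil => rfl
    | cons b l =>
      rw [weave, weave] at h
      exact absurd h.symm (List.append_ne_nil_of_left_ne_nil (block_ne_nil r b p) _)
  | cons b₁ l₁ ih =>
    intro l₂ h
    cases l₂ with
    | nil =>
      rw [weave, weave] at h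
      exact absurd h (List.append_ne_nil_of_left_ne_nil (block_ne_nil r b₁ p) _)
    | cons b₂ l₂ =>
      simp only [weave] at h
      have hb : b₁ = b₂ := by
        by_contra hne
        unfold block at h
        split_ifs at h with h1 h2 h2 <;> simp_all
      subst hb
      rw [List.append_cancel_left_eq] at h
      rw [ih _ _ h]

/-- The number of bottom-rail vertices at negative positions: `2k+1` for a left excursion of depth `2k+1`,
none otherwise. [cite: DuminilCopinSmirnov2012, §3 (Fig. 3)] -/
theorem countP_left_encode (left : Option ℕ) (l : List Bool) (right : Option ℕ) :
    (encode left l right).countP (fun a => a.1 == false && decide (a.2 < 0)) =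
      left.elim 0 (fun k => 2 * k + 1) := by
  have hw : (weave left.isSome 0 l).countP (fun a => a.1 == false && decide (a.2 < 0)) = 0 := by
    refine List.countP_eq_zero.2 fun a ha => ?_
    have := (mem_weave ha).1
    simp; intro; omega
  have hr : (right.elim [] (excR (wend left.isSome l) (2 * (l.length : ℤ)))).countP
      (fun a => a.1 == false && decide (a.2 < 0)) = 0 := by
    cases right with
    | none => rfl
    | some k =>
      refine List.countP_eq_zero.2 fun a ha => ?_
      rw [Option.elim_some] at ha
      rcases mem_excR ha with ⟨_, h2, _⟩ | ⟨_, h2, _⟩ <;> (simp; intro; omega)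
  have hp : (pre left).countP (fun a => a.1 == false && decide (a.2 < 0)) = left.elim 0 (fun k => 2 * k + 1) := by
    cases left with
    | none => simp [pre]
    | some k =>
      rw [pre, Option.elim_some, List.countP_cons_of_neg (by simp), Option.elim_some, excL, List.countP_append]
      rw [List.countP_eq_length.2, (List.countP_eq_zero).2]
      · simp
      · intro a ha
        obtain ⟨i, -, rfl⟩ := List.mem_map.1 ha
        simp
      · intro a ha
        obtain ⟨i, -, rfl⟩ := List.mem_map.1 ha
        simp; omega
  rw [encode, List.countP_append, List.countP_append, hp, hw, hr]
  simp

/-- The number of vertices beyond the final position `2|l|`: `4k'+2` for a right excursion of depth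
`2k'+1`, none otherwise. [cite: DuminilCopinSmirnov2012, §3 (Fig. 3)] -/
theorem countP_right_encode (left : Option ℕ) (l : List Bool) (right : Option ℕ) :
    (encode left l right).countP (fun a => decide (2 * (l.length : ℤ) < a.2)) =
      right.elim 0 (fun k => 4 * k + 2) := by
  have hp : (pre left).countP (fun a => decide (2 * (l.length : ℤ) < a.2)) = 0 := by
    refine List.countP_eq_zero.2 fun a ha => ?_
    have := mem_pre ha
    simp; omega
  have hw : (weave left.isSome 0 l).countP (fun a => decide (2 * (l.length : ℤ) < a.2)) = 0 := by
    refine List.countP_eq_zero.2 fun a ha => ?_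
    have := (mem_weave ha).2.1
    simp; omega
  have hr : (right.elim [] (excR (wend left.isSome l) (2 * (l.length : ℤ)))).countP
      (fun a => decide (2 * (l.length : ℤ) < a.2)) = right.elim 0 (fun k => 4 * k + 2) := by
    cases right with
    | none => rfl
    | some k =>
      set c := wend left.isSome l
      set e : ℤ := 2 * (l.length : ℤ)
      rw [Option.elim_some, Option.elim_some, excR, List.countP_append]
      have h1 : ((List.range (2 * k + 1)).map (fun i : ℕ => (c, e + 1 + i))).countP
          (fun a => decide (e < a.2)) = 2 * k + 1 := by
        rw [List.countP_eq_length.2]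
        · simp
        · intro a ha
          obtain ⟨i, -, rfl⟩ := List.mem_map.1 ha
          simp; omega
      have h2 : ((List.range (2 * k + 2)).map (fun i : ℕ => (!c, e + (2 * k + 1) - i))).countP
          (fun a => decide (e < a.2)) = 2 * k + 1 := by
        rw [List.range_succ, List.map_append, List.countP_append, List.countP_eq_length.2,
          List.map_singleton, (List.countP_eq_zero).2]
        · simp
        · intro a ha; simp at ha; subst ha; simp
        · intro a ha
          obtain ⟨i, hi, rfl⟩ := List.mem_map.1 ha
          rw [List.mem_range] at hi
          simp; omega
      rw [h1, h2]; ring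
  rw [encode, List.countP_append, List.countP_append, hp, hw, hr]
  simp

/-- **`encode` is injective on admissible parameters.** [cite: DuminilCopinSmirnov2012, §3 (Fig. 3)] -/
theorem encode_inj {left₁ left₂ : Option ℕ} {l₁ l₂ : List Bool} {right₁ right₂ : Option ℕ}
    (h₁ : l₁ ≠ [] ∨ left₁ = none) (h₂ : l₂ ≠ [] ∨ left₂ = none)
    (h : encode left₁ l₁ right₁ = encode left₂ l₂ right₂) :
    left₁ = left₂ ∧ l₁ = l₂ ∧ right₁ = right₂ := by
  -- the last entry gives the weave length and the final rail
  have hlast := getLast?_encode left₁ l₁ right₁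
  rw [h, getLast?_encode] at hlast
  simp only [Option.some.injEq, Prod.mk.injEq] at hlast
  obtain ⟨hf, hlen⟩ := hlast
  have hlen' : l₁.length = l₂.length := by omega
  -- the left excursions
  have hL := countP_left_encode left₁ l₁ right₁
  rw [h, countP_left_encode] at hL
  have hleft : left₁ = left₂ := by
    cases left₁ with
    | none => cases left₂ with
      | none => rfl
      | some k => simp at hL
    | some k₁ => cases left₂ with
      | none => simp at hL
      | some k₂ => simp at hL; rw [hL]
  subst hleft
  -- the right excursions
  have hR := countP_right_encode left₁ l₁ right₁
  rw [h, ← hlen, countP_right_encode] at hR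
  have hright : right₁ = right₂ := by
    cases right₁ with
    | none => cases right₂ with
      | none => rfl
      | some k => simp at hR
    | some k₁ => cases right₂ with
      | none => simp at hR
      | some k₂ => simp only [Option.elim_some] at hR; congr 1; omega
  subst hright
  refine ⟨rfl, ?_, rfl⟩
  -- the weave ends agree, hence the right excursions agree as lists; cancel them and the prefix
  have hc : wend left₁.isSome l₁ = wend left₁.isSome l₂ := by
    cases right₁ with
    | none => simpa [frail] using hf.symm
    | some k => simpa [frail] using hf.symm
  rw [encode, encode, ← hc, hlen, List.append_cancel_right_eq, List.append_cancel_left_eq] at h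
  exact weave_injective _ _ h

/-- **Distinct admissible parameters give distinct family walks** (same side `s`): the key to counting the
family inside `B_{2,L}` and `A_{2,L}`. [cite: DuminilCopinSmirnov2012, §3 (Fig. 3)] -/
theorem famWalk_inj {s : ℤ} (hs : s = 1 ∨ s = -1) {left₁ left₂ : Option ℕ} {l₁ l₂ : List Bool}
    {right₁ right₂ : Option ℕ} (h₁ : l₁ ≠ [] ∨ left₁ = none) (h₂ : l₂ ≠ [] ∨ left₂ = none)
    (h : famWalk s left₁ l₁ right₁ = famWalk s left₂ l₂ right₂) :
    left₁ = left₂ ∧ l₁ = l₂ ∧ right₁ = right₂ := by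
  have hs0 : s ≠ 0 := by rcases hs with rfl | rfl <;> norm_num
  rw [famWalk, famWalk, walkOfA, walkOfA] at h
  have h1 := List.cons_injective h
  obtain ⟨h2, -⟩ := List.append_inj' h1 rfl
  have h3 : (encode left₁ l₁ right₁).map (smap s) = (encode left₂ l₂ right₂).map (smap s) :=
    (List.map_injective_iff.2 ladV_injective) h2
  exact encode_inj h₁ h₂ ((List.map_injective_iff.2 (smap_injective hs0)) h3)

/-! ### §6. Parameter sets and their generating sums -/

/-- Boolean words of length `n` (the weave words). [cite: DuminilCopinSmirnov2012, §3 (Fig. 3)] -/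
def bwords : ℕ → Finset (List Bool)
  | 0 => {[]}
  | n + 1 => (bwords n).map ⟨List.cons false, List.cons_injective⟩ ∪
      (bwords n).map ⟨List.cons true, List.cons_injective⟩

/-- Words in `bwords n` have length `n`. [folklore] -/
private theorem length_of_mem_bwords {n : ℕ} {l : List Bool} (h : l ∈ bwords n) : l.length = n := by
  induction n generalizing l with
  | zero => simp [bwords] at h; subst h; rfl
  | succ n ih =>
    simp only [bwords, Finset.mem_union, Finset.mem_map, Function.Embedding.coeFn_mk] at h
    rcases h with ⟨l', hl', rfl⟩ | ⟨l', hl', rfl⟩ <;> simp [ih hl']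

/-- Summing over words of length `n+1` by the first letter. [folklore] -/
private theorem sum_bwords_succ (n : ℕ) (f : List Bool → ℝ) :
    ∑ l ∈ bwords (n + 1), f l = ∑ l ∈ bwords n, (f (false :: l) + f (true :: l)) := by
  rw [bwords, Finset.sum_union, Finset.sum_map, Finset.sum_map, ← Finset.sum_add_distrib]
  · rfl
  · rw [Finset.disjoint_left]
    rintro l h1 h2
    simp only [Finset.mem_map, Function.Embedding.coeFn_mk] at h1 h2
    obtain ⟨l1, -, rfl⟩ := h1
    obtain ⟨l2, -, h⟩ := h2
    simp at h

/-- The weave transfer sum over words of length `n` from rail `r`, with end weight `g`: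
`Σ_l x^{wlen r l} g(wend r l)`. [cite: DuminilCopinSmirnov2012, §3 (Fig. 3)] -/
def wsum (x : ℝ) (g : Bool → ℝ) (n : ℕ) (r : Bool) : ℝ := ∑ l ∈ bwords n, x ^ wlen r l * g (wend r l)

/-- `wsum` at length `0`. [folklore] -/
private theorem wsum_zero (x : ℝ) (g : Bool → ℝ) (r : Bool) : wsum x g 0 r = g r := by
  simp [wsum, bwords, wlen, wend]

/-- The `2 × 2` transfer step of the weave: `W_{n+1}(r) = x^{2 or 3} W_n(false) + x^{3 or 2} W_n(true)`.
[cite: DuminilCopinSmirnov2012, §3 (Fig. 3)] -/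
theorem wsum_succ (x : ℝ) (g : Bool → ℝ) (n : ℕ) (r : Bool) :
    wsum x g (n + 1) r = x ^ (if false = r then 2 else 3) * wsum x g n false +
      x ^ (if true = r then 2 else 3) * wsum x g n true := by
  rw [wsum, sum_bwords_succ, wsum, wsum, Finset.mul_sum, Finset.mul_sum, ← Finset.sum_add_distrib]
  refine Finset.sum_congr rfl fun l _ => ?_
  simp only [wlen, wend, pow_add]
  ring

/-- **Closed form of the weave transfer sum**: with `a = x² + x³`, `b = x² − x³`,
`W_n(r) = ½(aⁿ + bⁿ) g(r) + ½(aⁿ − bⁿ) g(¬r)`. [cite: DuminilCopinSmirnov2012, §3 (Fig. 3)] -/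
theorem wsum_eq (x : ℝ) (g : Bool → ℝ) (n : ℕ) (r : Bool) :
    wsum x g n r = ((x ^ 2 + x ^ 3) ^ n + (x ^ 2 - x ^ 3) ^ n) / 2 * g r +
      ((x ^ 2 + x ^ 3) ^ n - (x ^ 2 - x ^ 3) ^ n) / 2 * g (!r) := by
  induction n generalizing r with
  | zero => simp [wsum_zero]
  | succ n ih =>
    rw [wsum_succ, ih, ih]
    cases r <;> simp <;> ring

/-- The excursion sum `Σ_{k<N} x^{4k+3}` (depths `2k+1`, `4k+3` vertices). [cite: DuminilCopinSmirnov2012, §3 (Fig. 3)] -/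
def rsum (x : ℝ) (N : ℕ) : ℝ := ∑ k ∈ Finset.range N, x ^ (4 * k + 3)

/-- `Σ_{n<N} ½(a^{n+1} + b^{n+1})`, the even weave partial sum. [cite: DuminilCopinSmirnov2012, §3 (Fig. 3)] -/
def sE (x : ℝ) (N : ℕ) : ℝ := ∑ n ∈ Finset.range N, ((x ^ 2 + x ^ 3) ^ (n + 1) + (x ^ 2 - x ^ 3) ^ (n + 1)) / 2

/-- `Σ_{n<N} ½(a^{n+1} − b^{n+1})`, the odd weave partial sum. [cite: DuminilCopinSmirnov2012, §3 (Fig. 3)] -/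
def sO (x : ℝ) (N : ℕ) : ℝ := ∑ n ∈ Finset.range N, ((x ^ 2 + x ^ 3) ^ (n + 1) - (x ^ 2 - x ^ 3) ^ (n + 1)) / 2

/-- `Σ_{n<N} W_{n+1}(r) = g(r) sE + g(¬r) sO`. [folklore] -/
private theorem sum_wsum_eq (x : ℝ) (g : Bool → ℝ) (N : ℕ) (r : Bool) :
    ∑ n ∈ Finset.range N, wsum x g (n + 1) r = g r * sE x N + g (!r) * sO x N := by
  simp only [wsum_eq, sE, sO, Finset.mul_sum, ← Finset.sum_add_distrib]
  exact Finset.sum_congr rfl fun n _ => by ring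

/-- Parameters `(s, left, l, right)`. [cite: DuminilCopinSmirnov2012, §3 (Fig. 3)] -/
abbrev Param : Type := ℤ × Option ℕ × List Bool × Option ℕ

/-- The walk of a parameter. [cite: DuminilCopinSmirnov2012, §3 (Fig. 3)] -/
def fw (q : Param) : List HV := famWalk q.1 q.2.1 q.2.2.1 q.2.2.2

/-- The length of a parameter's walk. [cite: DuminilCopinSmirnov2012, §3 (Fig. 3)] -/
def qlen (q : Param) : ℕ := elen q.2.1 q.2.2.1 q.2.2.2

/-- The final rail of a parameter's walk. [cite: DuminilCopinSmirnov2012, §3 (Fig. 3)] -/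
def qrail (q : Param) : Bool := frail q.2.1 q.2.2.1 q.2.2.2

/-- The two sides of `a`. [cite: DuminilCopinSmirnov2012, §3 (Fig. 3)] -/
def signs : Finset ℤ := {1, -1}

/-- `none` and the excursion depths `< N`. [cite: DuminilCopinSmirnov2012, §3 (Fig. 3)] -/
def optN (N : ℕ) : Finset (Option ℕ) := Finset.insertNone (Finset.range N)

/-- Nonempty weave words of length `≤ N`. [cite: DuminilCopinSmirnov2012, §3 (Fig. 3)] -/
def wordsN (N : ℕ) : Finset (List Bool) := (Finset.range N).biUnion fun n => bwords (n + 1)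

/-- Parameters with a nonempty weave, all sizes `≤ N`. [cite: DuminilCopinSmirnov2012, §3 (Fig. 3)] -/
def paramsW (N : ℕ) : Finset Param := signs ×ˢ (optN N ×ˢ (wordsN N ×ˢ optN N))

/-- Parameters of the walks exiting through `β` straight above `a`: empty weave, no left excursion,
a right excursion. [cite: DuminilCopinSmirnov2012, §3 (Fig. 3)] -/
def paramsZ (N : ℕ) : Finset Param :=
  signs ×ˢ (({none} : Finset (Option ℕ)) ×ˢ (({[]} : Finset (List Bool)) ×ˢ (Finset.range N).image some))

/-- The `β`-family parameters. [cite: DuminilCopinSmirnov2012, §3 (β)] -/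
def paramsB (N : ℕ) : Finset Param := (paramsW N).filter (fun q => qrail q = true) ∪ paramsZ N

/-- The `α`-family parameters. [cite: DuminilCopinSmirnov2012, §3 (α)] -/
def paramsA (N : ℕ) : Finset Param := (paramsW N).filter (fun q => qrail q = false)

/-- `1 ≠ -1` in `ℤ`. [folklore] -/
private theorem sum_signs (c : ℝ) : ∑ _s ∈ signs, c = 2 * c := by
  rw [signs, Finset.sum_pair (by norm_num)]; ring

/-- Summing the `β` weights over the right excursions. [cite: DuminilCopinSmirnov2012, §3 (Fig. 3)] -/
theorem sum_right_beta (x : ℝ) (N : ℕ) (left : Option ℕ) (l : List Bool) :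
    ∑ right ∈ optN N, (if frail left l right = true then x ^ elen left l right else 0) =
      x ^ (1 + left.elim 0 (fun k => 4 * k + 3) + wlen left.isSome l) *
        (if wend left.isSome l then 1 else rsum x N) := by
  rw [optN, Finset.sum_insertNone]
  cases h : wend left.isSome l <;> simp [frail, elen, h, rsum, pow_add, Finset.mul_sum]

/-- Summing the `α` weights over the right excursions. [cite: DuminilCopinSmirnov2012, §3 (Fig. 3)] -/
theorem sum_right_alpha (x : ℝ) (N : ℕ) (left : Option ℕ) (l : List Bool) :
    ∑ right ∈ optN N, (if frail left l right = false then x ^ elen left l right else 0) =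
      x ^ (1 + left.elim 0 (fun k => 4 * k + 3) + wlen left.isSome l) *
        (if wend left.isSome l then rsum x N else 1) := by
  rw [optN, Finset.sum_insertNone]
  cases h : wend left.isSome l <;> simp [frail, elen, h, rsum, pow_add, Finset.mul_sum]

/-- Summing over the weave words by length. [cite: DuminilCopinSmirnov2012, §3 (Fig. 3)] -/
theorem sum_words (x : ℝ) (N : ℕ) (E : ℕ) (r : Bool) (G : Bool → ℝ) :
    ∑ l ∈ wordsN N, x ^ (1 + E + wlen r l) * G (wend r l) =
      x ^ (1 + E) * ∑ n ∈ Finset.range N, wsum x G (n + 1) r := by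
  rw [Finset.mul_sum, wordsN, Finset.sum_biUnion]
  · refine Finset.sum_congr rfl fun n _ => ?_
    rw [wsum, Finset.mul_sum]
    exact Finset.sum_congr rfl fun l _ => by rw [pow_add]; ring
  · intro n _ m _ hnm
    rw [Function.onFun, Finset.disjoint_left]
    intro l h1 h2
    exact hnm (by have := length_of_mem_bwords h1; have := length_of_mem_bwords h2; omega)

/-- Summing over the left excursions. [cite: DuminilCopinSmirnov2012, §3 (Fig. 3)] -/
theorem sum_left (x : ℝ) (N : ℕ) (Ψ : Bool → ℝ) :
    ∑ left ∈ optN N, x ^ (1 + left.elim 0 (fun k => 4 * k + 3)) * Ψ left.isSome =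
      x * (Ψ false + rsum x N * Ψ true) := by
  rw [optN, Finset.sum_insertNone]
  simp only [Option.elim_none, Option.isSome_none, Option.elim_some, Option.isSome_some, add_zero, pow_one]
  have : ∑ k ∈ Finset.range N, x ^ (1 + (4 * k + 3)) * Ψ true = x * (rsum x N * Ψ true) := by
    rw [rsum, Finset.sum_mul, Finset.mul_sum]
    exact Finset.sum_congr rfl fun k _ => by rw [pow_add, pow_one]; ring
  rw [this]; ring

/-- **The `β`-family partial sum in closed form.** [cite: DuminilCopinSmirnov2012, §3 (Fig. 3)] -/
theorem sum_paramsB (x : ℝ) (N : ℕ) :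
    ∑ q ∈ paramsB N, x ^ qlen q =
      2 * (x * ((rsum x N * sE x N + sO x N) + rsum x N * (sE x N + rsum x N * sO x N))) +
        2 * (x * rsum x N) := by
  have hdisj : Disjoint ((paramsW N).filter (fun q => qrail q = true)) (paramsZ N) := by
    rw [Finset.disjoint_left]
    rintro ⟨s, left, l, right⟩ h1 h2
    simp only [Finset.mem_filter, paramsW, paramsZ, Finset.mem_product, Finset.mem_singleton] at h1 h2
    obtain ⟨⟨-, -, hl, -⟩, -⟩ := h1
    obtain ⟨-, -, rfl, -⟩ := h2
    simp only [wordsN, Finset.mem_biUnion] at hl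
    obtain ⟨n, -, hn⟩ := hl
    have := length_of_mem_bwords hn
    simp at this
  rw [paramsB, Finset.sum_union hdisj]
  congr 1
  · rw [Finset.sum_filter, paramsW, Finset.sum_product]
    simp only [Finset.sum_product, qrail, qlen]
    rw [sum_signs]
    congr 1
    set G : Bool → ℝ := fun c => if c then 1 else rsum x N with hG
    have step : ∀ left : Option ℕ, ∑ l ∈ wordsN N, ∑ right ∈ optN N,
        (if frail left l right = true then x ^ elen left l right else 0) =
        x ^ (1 + left.elim 0 (fun k => 4 * k + 3)) *
          ∑ n ∈ Finset.range N, wsum x G (n + 1) left.isSome := by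
      intro left
      simp only [sum_right_beta]
      exact sum_words x N _ left.isSome G
    simp only [step]
    rw [show (∑ left ∈ optN N, x ^ (1 + left.elim 0 (fun k => 4 * k + 3)) *
        ∑ n ∈ Finset.range N, wsum x G (n + 1) left.isSome) = _ from
      sum_left x N (fun r => ∑ n ∈ Finset.range N, wsum x G (n + 1) r)]
    have h1 : G false = rsum x N := by simp [hG]
    have h2 : G true = 1 := by simp [hG]
    simp only [sum_wsum_eq, Bool.not_false, Bool.not_true, h1, h2]
    ring
  · rw [paramsZ, Finset.sum_product]
    simp only [Finset.sum_product, Finset.sum_singleton, qlen]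
    rw [sum_signs, Finset.sum_image (fun a _ b _ h => Option.some_injective _ h)]
    congr 1
    rw [rsum, Finset.mul_sum]
    refine Finset.sum_congr rfl fun k _ => ?_
    simp [elen, wlen, pow_add]

/-- **The `α`-family partial sum in closed form.** [cite: DuminilCopinSmirnov2012, §3 (Fig. 3)] -/
theorem sum_paramsA (x : ℝ) (N : ℕ) :
    ∑ q ∈ paramsA N, x ^ qlen q =
      2 * (x * ((sE x N + rsum x N * sO x N) + rsum x N * (rsum x N * sE x N + sO x N))) := by
  rw [paramsA, Finset.sum_filter, paramsW, Finset.sum_product]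
  simp only [Finset.sum_product, qrail, qlen]
  rw [sum_signs]
  congr 1
  set G : Bool → ℝ := fun c => if c then rsum x N else 1 with hG
  have step : ∀ left : Option ℕ, ∑ l ∈ wordsN N, ∑ right ∈ optN N,
      (if frail left l right = false then x ^ elen left l right else 0) =
      x ^ (1 + left.elim 0 (fun k => 4 * k + 3)) *
        ∑ n ∈ Finset.range N, wsum x G (n + 1) left.isSome := by
    intro left
    simp only [sum_right_alpha]
    exact sum_words x N _ left.isSome G
  simp only [step]
  rw [show (∑ left ∈ optN N, x ^ (1 + left.elim 0 (fun k => 4 * k + 3)) *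
      ∑ n ∈ Finset.range N, wsum x G (n + 1) left.isSome) = _ from
    sum_left x N (fun r => ∑ n ∈ Finset.range N, wsum x G (n + 1) r)]
  have h1 : G false = 1 := by simp [hG]
  have h2 : G true = rsum x N := by simp [hG]
  simp only [sum_wsum_eq, Bool.not_false, Bool.not_true, h1, h2]
  ring

/-! ### §7. The family sums are bounded by `B_{2,2N}` and `A_{2,2N}` -/

/-- Unpacking membership in `paramsW N`. [folklore] -/
private theorem mem_paramsW {N : ℕ} {s : ℤ} {left : Option ℕ} {l : List Bool} {right : Option ℕ}
    (h : (s, left, l, right) ∈ paramsW N) :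
    (s = 1 ∨ s = -1) ∧ (∀ k, left = some k → k < N) ∧ l ≠ [] ∧ l.length ≤ N ∧
      (∀ k, right = some k → k < N) := by
  simp only [paramsW, signs, optN, wordsN, Finset.mem_product, Finset.mem_insert, Finset.mem_singleton,
    Finset.mem_insertNone, Finset.mem_range, Finset.mem_biUnion] at h
  obtain ⟨hs, hleft, ⟨n, hn, hl⟩, hright⟩ := h
  have hlen := length_of_mem_bwords hl
  refine ⟨hs, fun k hk => hleft k (by simp [hk]), ?_, by omega, fun k hk => hright k (by simp [hk])⟩
  rintro rfl; simp at hlen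

/-- Unpacking membership in `paramsZ N`. [folklore] -/
private theorem mem_paramsZ {N : ℕ} {s : ℤ} {left : Option ℕ} {l : List Bool} {right : Option ℕ}
    (h : (s, left, l, right) ∈ paramsZ N) :
    (s = 1 ∨ s = -1) ∧ left = none ∧ l = [] ∧ ∃ k, k < N ∧ right = some k := by
  simp only [paramsZ, signs, Finset.mem_product, Finset.mem_insert, Finset.mem_singleton,
    Finset.mem_image, Finset.mem_range] at h
  obtain ⟨hs, rfl, rfl, ⟨k, hk, rfl⟩⟩ := h
  exact ⟨hs, rfl, rfl, k, hk, rfl⟩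

/-- The final dart of a parameter's walk determines `(final rail, s · 2|l|)`. [cite: DuminilCopinSmirnov2012, §3 (Fig. 3)] -/
theorem fw_final_eq {s₁ s₂ : ℤ} {left₁ left₂ : Option ℕ} {l₁ l₂ : List Bool} {right₁ right₂ : Option ℕ}
    (h : fw (s₁, left₁, l₁, right₁) = fw (s₂, left₂, l₂, right₂)) :
    frail left₁ l₁ right₁ = frail left₂ l₂ right₂ ∧
      s₁ * (2 * (l₁.length : ℤ)) = s₂ * (2 * (l₂.length : ℤ)) := by
  have h1 := congrArg finalDart h
  simp only [fw] at h1
  rw [finalDart_famWalk, finalDart_famWalk, Prod.mk.injEq] at h1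
  have h2 := ladV_injective (a₁ := (frail left₁ l₁ right₁, _)) (a₂ := (frail left₂ l₂ right₂, _)) h1.1
  simp only [Prod.mk.injEq] at h2
  exact h2

/-- The `e = 0` walks: side and depth are determined. [cite: DuminilCopinSmirnov2012, §3 (Fig. 3)] -/
theorem famWalk_Z_inj {s₁ s₂ : ℤ} {k₁ k₂ : ℕ}
    (h : famWalk s₁ none [] (some k₁) = famWalk s₂ none [] (some k₂)) : s₁ = s₂ ∧ k₁ = k₂ := by
  have hk : k₁ = k₂ := by
    have := congrArg mwLen h
    rw [mwLen_famWalk, mwLen_famWalk] at this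
    simp [elen, wlen] at this
    omega
  refine ⟨?_, hk⟩
  have hex : ∀ k : ℕ, excR false 0 k = (false, 1) :: (excR false 0 k).tail := fun k =>
    List.eq_cons_of_mem_head? (by rw [head?_excR]; simp)
  have hform : ∀ (s : ℤ) (k : ℕ), famWalk s none [] (some k) =
      wOut :: ladV (smap s (false, 0)) :: ladV (smap s (false, 1)) ::
        (((excR false 0 k).tail.map (smap s)).map ladV ++ [exitOf (frail none [] (some k)) (s * (2 * 0))]) := by
    intro s k
    rw [famWalk, walkOfA, encode]
    simp only [pre, Option.elim_none, Option.isSome_none, weave, List.append_nil, Option.elim_some, wend,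
      List.length_nil, Nat.cast_zero, mul_zero, List.singleton_append]
    rw [hex k]
    simp
  rw [hform, hform] at h
  simp only [List.cons.injEq] at h
  have h3 := ladV_injective h.2.2.1
  simp only [smap, Prod.mk.injEq, mul_one, true_and] at h3
  exact h3

/-- **`fw` is injective on the `β` parameters.** [cite: DuminilCopinSmirnov2012, §3 (Fig. 3)] -/
theorem fw_injOn_paramsB (N : ℕ) : Set.InjOn fw (paramsB N) := by
  rintro ⟨s₁, left₁, l₁, right₁⟩ hq₁ ⟨s₂, left₂, l₂, right₂⟩ hq₂ h
  obtain ⟨hf, he⟩ := fw_final_eq h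
  simp only [fw] at h
  rw [paramsB, Finset.coe_union, Set.mem_union, Finset.mem_coe, Finset.mem_coe, Finset.mem_filter] at hq₁ hq₂
  rcases hq₁ with ⟨hq₁, -⟩ | hq₁ <;> rcases hq₂ with ⟨hq₂, -⟩ | hq₂
  · obtain ⟨hs₁, _, hl₁, _, _⟩ := mem_paramsW hq₁
    obtain ⟨hs₂, _, hl₂, _, _⟩ := mem_paramsW hq₂
    have h1 : (0 : ℤ) < l₁.length := by exact_mod_cast List.length_pos_of_ne_nil hl₁
    have h2 : (0 : ℤ) < l₂.length := by exact_mod_cast List.length_pos_of_ne_nil hl₂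
    have hs : s₁ = s₂ := by
      rcases hs₁ with rfl | rfl <;> rcases hs₂ with rfl | rfl <;> first | rfl | (exfalso; nlinarith)
    subst hs
    obtain ⟨rfl, rfl, rfl⟩ := famWalk_inj hs₁ (Or.inl hl₁) (Or.inl hl₂) h
    rfl
  · obtain ⟨hs₁, _, hl₁, _, _⟩ := mem_paramsW hq₁
    obtain ⟨hs₂, rfl, rfl, k₂, _, rfl⟩ := mem_paramsZ hq₂
    have h1 : (0 : ℤ) < l₁.length := by exact_mod_cast List.length_pos_of_ne_nil hl₁
    exfalso
    simp only [List.length_nil, Nat.cast_zero, mul_zero] at he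
    rcases hs₁ with rfl | rfl <;> omega
  · obtain ⟨hs₁, rfl, rfl, k₁, _, rfl⟩ := mem_paramsZ hq₁
    obtain ⟨hs₂, _, hl₂, _, _⟩ := mem_paramsW hq₂
    have h2 : (0 : ℤ) < l₂.length := by exact_mod_cast List.length_pos_of_ne_nil hl₂
    exfalso
    simp only [List.length_nil, Nat.cast_zero, mul_zero] at he
    rcases hs₂ with rfl | rfl <;> omega
  · obtain ⟨hs₁, rfl, rfl, k₁, _, rfl⟩ := mem_paramsZ hq₁
    obtain ⟨hs₂, rfl, rfl, k₂, _, rfl⟩ := mem_paramsZ hq₂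
    obtain ⟨rfl, rfl⟩ := famWalk_Z_inj h
    rfl

/-- **`fw` is injective on the `α` parameters.** [cite: DuminilCopinSmirnov2012, §3 (Fig. 3)] -/
theorem fw_injOn_paramsA (N : ℕ) : Set.InjOn fw (paramsA N) := by
  rintro ⟨s₁, left₁, l₁, right₁⟩ hq₁ ⟨s₂, left₂, l₂, right₂⟩ hq₂ h
  obtain ⟨hf, he⟩ := fw_final_eq h
  simp only [fw] at h
  rw [paramsA, Finset.mem_coe, Finset.mem_filter] at hq₁ hq₂
  obtain ⟨hs₁, _, hl₁, _, _⟩ := mem_paramsW hq₁.1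
  obtain ⟨hs₂, _, hl₂, _, _⟩ := mem_paramsW hq₂.1
  have h1 : (0 : ℤ) < l₁.length := by exact_mod_cast List.length_pos_of_ne_nil hl₁
  have h2 : (0 : ℤ) < l₂.length := by exact_mod_cast List.length_pos_of_ne_nil hl₂
  have hs : s₁ = s₂ := by
    rcases hs₁ with rfl | rfl <;> rcases hs₂ with rfl | rfl <;> first | rfl | (exfalso; nlinarith)
  subst hs
  obtain ⟨rfl, rfl, rfl⟩ := famWalk_inj hs₁ (Or.inl hl₁) (Or.inl hl₂) h
  rfl

/-- The `β`-family walks are `β`-walks of `S_{2,2N}`. [cite: DuminilCopinSmirnov2012, §3 (β)] -/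
theorem fw_mem_beta {N : ℕ} {q : Param} (hq : q ∈ paramsB N) :
    fw q ∈ (midWalks (stripV 2 (2 * N))).filter fun P => IsBetaDart 2 (finalDart P) := by
  obtain ⟨s, left, l, right⟩ := q
  rw [Finset.mem_filter, fw]
  rw [paramsB, Finset.mem_union, Finset.mem_filter] at hq
  rcases hq with ⟨hq, hf⟩ | hq
  · obtain ⟨hs, hleft, hl, hlen, hright⟩ := mem_paramsW hq
    exact ⟨famWalk_mem hs (Or.inl hl) hleft hlen hright, famWalk_beta hs hf⟩
  · obtain ⟨hs, h1, h2, k, hk, h3⟩ := mem_paramsZ hq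
    subst h1; subst h2; subst h3
    refine ⟨famWalk_mem hs (Or.inr ⟨rfl, rfl⟩) (by simp) (by simp) (fun k' hk' => ?_), famWalk_beta hs ?_⟩
    · simp only [Option.some.injEq] at hk'; subst hk'; exact hk
    · simp [frail, wend]

/-- The `α`-family walks are `α`-walks of `S_{2,2N}`. [cite: DuminilCopinSmirnov2012, §3 (α)] -/
theorem fw_mem_alpha {N : ℕ} {q : Param} (hq : q ∈ paramsA N) :
    fw q ∈ (midWalks (stripV 2 (2 * N))).filter fun P => IsAlphaDart (finalDart P) := by
  obtain ⟨s, left, l, right⟩ := q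
  rw [Finset.mem_filter, fw]
  rw [paramsA, Finset.mem_filter] at hq
  obtain ⟨hq, hf⟩ := hq
  obtain ⟨hs, hleft, hl, hlen, hright⟩ := mem_paramsW hq
  exact ⟨famWalk_mem hs (Or.inl hl) hleft hlen hright, famWalk_alpha hs hf⟩

/-- **The `β`-family partial sum is at most `B_{2,2N}(x)`** (`x ≥ 0`). [cite: DuminilCopinSmirnov2012, §3 (B_{T,L})] -/
theorem sum_paramsB_le_stripB {x : ℝ} (hx : 0 ≤ x) (N : ℕ) :
    ∑ q ∈ paramsB N, x ^ qlen q ≤ stripB 2 (2 * N) x := by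
  have h1 : ∑ q ∈ paramsB N, x ^ qlen q = ∑ P ∈ (paramsB N).image fw, x ^ mwLen P := by
    rw [Finset.sum_image (fw_injOn_paramsB N)]
    refine Finset.sum_congr rfl fun q _ => ?_
    rw [fw, mwLen_famWalk, qlen]
  rw [h1, stripB]
  exact Finset.sum_le_sum_of_subset_of_nonneg (Finset.image_subset_iff.2 fun q hq => fw_mem_beta hq)
    fun P _ _ => pow_nonneg hx _

/-- **The `α`-family partial sum is at most `A_{2,2N}(x)`** (`x ≥ 0`). [cite: DuminilCopinSmirnov2012, §3 (A_{T,L})] -/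
theorem sum_paramsA_le_stripA {x : ℝ} (hx : 0 ≤ x) (N : ℕ) :
    ∑ q ∈ paramsA N, x ^ qlen q ≤ stripA 2 (2 * N) x := by
  have h1 : ∑ q ∈ paramsA N, x ^ qlen q = ∑ P ∈ (paramsA N).image fw, x ^ mwLen P := by
    rw [Finset.sum_image (fw_injOn_paramsA N)]
    refine Finset.sum_congr rfl fun q _ => ?_
    rw [fw, mwLen_famWalk, qlen]
  rw [h1, stripA]
  exact Finset.sum_le_sum_of_subset_of_nonneg (Finset.image_subset_iff.2 fun q hq => fw_mem_alpha hq)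
    fun P _ _ => pow_nonneg hx _

/-! ### §8. The limits of the family sums -/

/-- `Σ_{k<N} x^{4k+3} → x³/(1 − x⁴)`. [folklore] -/
private theorem tendsto_rsum {x : ℝ} (hx0 : 0 ≤ x) (hx1 : x < 1) :
    Tendsto (fun N => rsum x N) atTop (𝓝 (x ^ 3 / (1 - x ^ 4))) := by
  have hq : x ^ 4 < 1 := pow_lt_one₀ hx0 hx1 (by norm_num)
  have h := ((hasSum_geometric_of_lt_one (pow_nonneg hx0 4) hq).mul_left (x ^ 3)).tendsto_sum_nat
  rw [div_eq_mul_inv]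
  refine h.congr fun N => ?_
  rw [rsum]
  refine Finset.sum_congr rfl fun k _ => ?_
  rw [← pow_mul, ← pow_add]; ring_nf

/-- `sE → ½(a/(1−a) + b/(1−b))`, `a = x²+x³`, `b = x²−x³`. [folklore] -/
private theorem tendsto_sE {x : ℝ} (hx0 : 0 ≤ x) (hx1 : x < 1) (ha : x ^ 2 + x ^ 3 < 1) :
    Tendsto (fun N => sE x N) atTop
      (𝓝 (((x ^ 2 + x ^ 3) / (1 - (x ^ 2 + x ^ 3)) + (x ^ 2 - x ^ 3) / (1 - (x ^ 2 - x ^ 3))) / 2)) := by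
  set a := x ^ 2 + x ^ 3 with ha'
  set b := x ^ 2 - x ^ 3 with hb'
  have ha0 : 0 ≤ a := by positivity
  have hb0 : 0 ≤ b := by rw [hb']; nlinarith
  have hb1 : b < 1 := by rw [hb']; nlinarith
  have hA := (hasSum_geometric_of_lt_one ha0 ha).mul_left a
  have hB := (hasSum_geometric_of_lt_one hb0 hb1).mul_left b
  have h := ((hA.add hB).div_const 2).tendsto_sum_nat
  have hlim : (a * (1 - a)⁻¹ + b * (1 - b)⁻¹) / 2 = (a / (1 - a) + b / (1 - b)) / 2 := by
    simp [div_eq_mul_inv]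
  rw [← hlim]
  refine h.congr fun N => ?_
  rw [sE]
  refine Finset.sum_congr rfl fun n _ => ?_
  rw [pow_succ, pow_succ]; ring

/-- `sO → ½(a/(1−a) − b/(1−b))`. [folklore] -/
private theorem tendsto_sO {x : ℝ} (hx0 : 0 ≤ x) (hx1 : x < 1) (ha : x ^ 2 + x ^ 3 < 1) :
    Tendsto (fun N => sO x N) atTop
      (𝓝 (((x ^ 2 + x ^ 3) / (1 - (x ^ 2 + x ^ 3)) - (x ^ 2 - x ^ 3) / (1 - (x ^ 2 - x ^ 3))) / 2)) := by
  set a := x ^ 2 + x ^ 3 with ha'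
  set b := x ^ 2 - x ^ 3 with hb'
  have ha0 : 0 ≤ a := by positivity
  have hb0 : 0 ≤ b := by rw [hb']; nlinarith
  have hb1 : b < 1 := by rw [hb']; nlinarith
  have hA := (hasSum_geometric_of_lt_one ha0 ha).mul_left a
  have hB := (hasSum_geometric_of_lt_one hb0 hb1).mul_left b
  have h := ((hA.sub hB).div_const 2).tendsto_sum_nat
  have hlim : (a * (1 - a)⁻¹ - b * (1 - b)⁻¹) / 2 = (a / (1 - a) - b / (1 - b)) / 2 := by
    simp [div_eq_mul_inv]
  rw [← hlim]
  refine h.congr fun N => ?_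
  rw [sO]
  refine Finset.sum_congr rfl fun n _ => ?_
  rw [pow_succ, pow_succ]; ring

/-- The excursion series `R(x) = x³/(1−x⁴)`. [cite: DuminilCopinSmirnov2012, §3 (Fig. 3)] -/
def Rinf (x : ℝ) : ℝ := x ^ 3 / (1 - x ^ 4)
/-- The even weave series. [cite: DuminilCopinSmirnov2012, §3 (Fig. 3)] -/
def SEinf (x : ℝ) : ℝ := ((x ^ 2 + x ^ 3) / (1 - (x ^ 2 + x ^ 3)) + (x ^ 2 - x ^ 3) / (1 - (x ^ 2 - x ^ 3))) / 2
/-- The odd weave series. [cite: DuminilCopinSmirnov2012, §3 (Fig. 3)] -/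
def SOinf (x : ℝ) : ℝ := ((x ^ 2 + x ^ 3) / (1 - (x ^ 2 + x ^ 3)) - (x ^ 2 - x ^ 3) / (1 - (x ^ 2 - x ^ 3))) / 2

/-- **The generating function of the `β`-family**, `B₂(x) = 2x[S_O(1+R²) + 2R S_E + R]`.
[cite: DuminilCopinSmirnov2012, §3 (B_T)] -/
def limB (x : ℝ) : ℝ :=
  2 * (x * ((Rinf x * SEinf x + SOinf x) + Rinf x * (SEinf x + Rinf x * SOinf x))) + 2 * (x * Rinf x)

/-- Half the generating function of the `α`-family divided by `x`: `E_A(x) = S_E(1+R²) + 2R S_O`,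
`A₂(x) = 2x E_A(x)`. [cite: DuminilCopinSmirnov2012, §3 (A_T)] -/
def EA (x : ℝ) : ℝ := (SEinf x + Rinf x * SOinf x) + Rinf x * (Rinf x * SEinf x + SOinf x)

/-- The `β`-family sums converge to `B₂(x)`. [cite: DuminilCopinSmirnov2012, §3 (B_T)] -/
theorem tendsto_sum_paramsB {x : ℝ} (hx0 : 0 ≤ x) (hx1 : x < 1) (ha : x ^ 2 + x ^ 3 < 1) :
    Tendsto (fun N => ∑ q ∈ paramsB N, x ^ qlen q) atTop (𝓝 (limB x)) := by
  simp only [sum_paramsB]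
  have hR := tendsto_rsum hx0 hx1
  have hE := tendsto_sE hx0 hx1 ha
  have hO := tendsto_sO hx0 hx1 ha
  unfold limB Rinf SEinf SOinf
  exact ((((hR.mul hE).add hO).add (hR.mul (hE.add (hR.mul hO)))).const_mul x |>.const_mul 2).add
    ((hR.const_mul x).const_mul 2)

/-- The `α`-family sums converge to `A₂(x) = 2x E_A(x)`. [cite: DuminilCopinSmirnov2012, §3 (A_T)] -/
theorem tendsto_sum_paramsA {x : ℝ} (hx0 : 0 ≤ x) (hx1 : x < 1) (ha : x ^ 2 + x ^ 3 < 1) :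
    Tendsto (fun N => ∑ q ∈ paramsA N, x ^ qlen q) atTop (𝓝 (2 * (x * EA x))) := by
  simp only [sum_paramsA]
  have hR := tendsto_rsum hx0 hx1
  have hE := tendsto_sE hx0 hx1 ha
  have hO := tendsto_sO hx0 hx1 ha
  unfold EA Rinf SEinf SOinf
  exact (((hE.add (hR.mul hO)).add (hR.mul ((hR.mul hE).add hO))).const_mul x).const_mul 2

/-! ### §9. The numbers at `x_c` -/

/-- `√2 = 2 − 2x_c²` (`x_c² = 1/(2+√2) = (2−√2)/2`). [cite: DuminilCopinSmirnov2012, §1 (x_c)] -/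
theorem sqrt_two_eq : Real.sqrt 2 = 2 - 2 * hexCriticalFugacity ^ 2 := by
  have hsq := hexCriticalFugacity_sq
  have hs : Real.sqrt 2 ^ 2 = 2 := Real.sq_sqrt (by norm_num)
  linear_combination (2 - Real.sqrt 2) * hsq + hexCriticalFugacity ^ 2 * hs

/-- The minimal polynomial: `1 − 4x_c² + 2x_c⁴ = 0`. [cite: DuminilCopinSmirnov2012, §1 (x_c)] -/
theorem minpoly_xc : 1 - 4 * hexCriticalFugacity ^ 2 + 2 * hexCriticalFugacity ^ 4 = 0 := by
  have h1 := sqrt_two_eq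
  have hs : Real.sqrt 2 ^ 2 = 2 := Real.sq_sqrt (by norm_num)
  linear_combination (-(Real.sqrt 2 + 2 - 2 * hexCriticalFugacity ^ 2) / 2) * h1 + (1 / 2 : ℝ) * hs

/-- `x_c² ≤ 3/10` (`x_c² = 0.2929`). [cite: DuminilCopinSmirnov2012, §1 (x_c)] -/
theorem xc_sq_le : hexCriticalFugacity ^ 2 ≤ 3 / 10 := by
  have h1 := sqrt_two_eq
  have h2 : (7 : ℝ) / 5 ≤ Real.sqrt 2 := by
    rw [show (7 / 5 : ℝ) = Real.sqrt ((7 / 5) ^ 2) by rw [Real.sqrt_sq (by norm_num)]]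
    exact Real.sqrt_le_sqrt (by norm_num)
  linarith

/-- `x_c² + x_c³ < 1` (the weave series converge at `x_c`; the width-2 strip is subcritical at `x_c`).
[cite: DuminilCopinSmirnov2012, §3 (proof of Theorem 1, Z(x) < ∞)] -/
theorem xc_weave_lt_one : hexCriticalFugacity ^ 2 + hexCriticalFugacity ^ 3 < 1 := by
  obtain ⟨h0, h1⟩ := hexCriticalFugacity_pos_lt_one
  have h2 := xc_sq_le
  nlinarith

/-- `cos(3π/8) · x_c = (1 − 2x_c²)/2` (`= (√2 − 1)/2`: `cos(3π/8) = √(2−√2)/2`, `x_c = 1/√(2+√2)`,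
`√(2−√2) = (√2−1)√(2+√2)`). [cite: DuminilCopinSmirnov2012, Lemma 2 (c_α = cos(3π/8))] -/
theorem cos_mul_xc : Real.cos (3 * Real.pi / 8) * hexCriticalFugacity = (1 - 2 * hexCriticalFugacity ^ 2) / 2 := by
  set r := Real.sqrt 2 with hr
  have hs : r ^ 2 = 2 := Real.sq_sqrt (by norm_num)
  have hr0 : 0 ≤ r := Real.sqrt_nonneg 2
  have hr1 : 1 ≤ r := by
    rw [hr, show (1 : ℝ) = Real.sqrt 1 by simp]
    exact Real.sqrt_le_sqrt (by norm_num)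
  have hcos : Real.cos (3 * Real.pi / 8) = Real.sqrt (2 - r) / 2 := by
    rw [show (3 * Real.pi / 8 : ℝ) = Real.pi / 2 - Real.pi / 8 by ring, Real.cos_pi_div_two_sub,
      Real.sin_pi_div_eight]
  have hkey : Real.sqrt (2 - r) = (r - 1) * Real.sqrt (2 + r) := by
    rw [← Real.sqrt_sq (by linarith : 0 ≤ r - 1), ← Real.sqrt_mul (sq_nonneg _)]
    congr 1
    linear_combination (-r) * hs
  have hpos : 0 < Real.sqrt (2 + r) := Real.sqrt_pos.2 (by linarith)
  rw [hcos, hkey, hexCriticalFugacity, ← hr]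
  field_simp
  rw [Real.sq_sqrt (by linarith)]
  linear_combination hs

/-- The nonvanishing denominators at `x_c`. [cite: DuminilCopinSmirnov2012, §3 (proof of Theorem 1)] -/
theorem xc_denoms : 1 - hexCriticalFugacity ^ 4 ≠ 0 ∧ 1 - (hexCriticalFugacity ^ 2 + hexCriticalFugacity ^ 3) ≠ 0 ∧
    1 - (hexCriticalFugacity ^ 2 - hexCriticalFugacity ^ 3) ≠ 0 := by
  obtain ⟨h0, h1⟩ := hexCriticalFugacity_pos_lt_one
  have h2 := xc_weave_lt_one
  have h4 : hexCriticalFugacity ^ 4 < 1 := pow_lt_one₀ h0.le h1 (by norm_num)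
  refine ⟨by linarith, by linarith, ?_⟩
  nlinarith

/-- `B₂(x)` as a rational function times its denominator `Q(x) = (1−x⁴)²(1−x²−x³)(1−x²+x³)`:
`B₂ Q = 4x⁴ − 8x⁸ + 4x¹⁰ + 4x¹² − 2x¹⁴`. [cite: DuminilCopinSmirnov2012, §3 (B_T)] -/
theorem limB_mul_den {x : ℝ} (h1 : 1 - x ^ 4 ≠ 0) (h2 : 1 - (x ^ 2 + x ^ 3) ≠ 0) (h3 : 1 - (x ^ 2 - x ^ 3) ≠ 0) :
    limB x * ((1 - x ^ 4) ^ 2 * (1 - (x ^ 2 + x ^ 3)) * (1 - (x ^ 2 - x ^ 3))) =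
      4 * x ^ 4 - 8 * x ^ 8 + 4 * x ^ 10 + 4 * x ^ 12 - 2 * x ^ 14 := by
  have h2' : 1 - x ^ 2 - x ^ 3 ≠ 0 := fun h => h2 (by linarith)
  have h3' : 1 - x ^ 2 + x ^ 3 ≠ 0 := fun h => h3 (by linarith)
  have e1 : Rinf x = x ^ 3 / (1 - x ^ 4) := rfl
  have e2 : SEinf x = ((x ^ 2 + x ^ 3) / (1 - x ^ 2 - x ^ 3) + (x ^ 2 - x ^ 3) / (1 - x ^ 2 + x ^ 3)) / 2 := by
    unfold SEinf; ring_nf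
  have e3 : SOinf x = ((x ^ 2 + x ^ 3) / (1 - x ^ 2 - x ^ 3) - (x ^ 2 - x ^ 3) / (1 - x ^ 2 + x ^ 3)) / 2 := by
    unfold SOinf; ring_nf
  have eD : (1 - x ^ 4) ^ 2 * (1 - (x ^ 2 + x ^ 3)) * (1 - (x ^ 2 - x ^ 3)) =
      (1 - x ^ 4) ^ 2 * (1 - x ^ 2 - x ^ 3) * (1 - x ^ 2 + x ^ 3) := by ring
  rw [limB, e1, e2, e3, eD]
  field_simp
  ring

/-- `E_A(x) Q(x) = x² − x⁴ + x⁶ + 3x⁸ − 4x¹⁰ + x¹⁴`. [cite: DuminilCopinSmirnov2012, §3 (A_T)] -/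
theorem EA_mul_den {x : ℝ} (h1 : 1 - x ^ 4 ≠ 0) (h2 : 1 - (x ^ 2 + x ^ 3) ≠ 0) (h3 : 1 - (x ^ 2 - x ^ 3) ≠ 0) :
    EA x * ((1 - x ^ 4) ^ 2 * (1 - (x ^ 2 + x ^ 3)) * (1 - (x ^ 2 - x ^ 3))) =
      x ^ 2 - x ^ 4 + x ^ 6 + 3 * x ^ 8 - 4 * x ^ 10 + x ^ 14 := by
  have h2' : 1 - x ^ 2 - x ^ 3 ≠ 0 := fun h => h2 (by linarith)
  have h3' : 1 - x ^ 2 + x ^ 3 ≠ 0 := fun h => h3 (by linarith)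
  have e1 : Rinf x = x ^ 3 / (1 - x ^ 4) := rfl
  have e2 : SEinf x = ((x ^ 2 + x ^ 3) / (1 - x ^ 2 - x ^ 3) + (x ^ 2 - x ^ 3) / (1 - x ^ 2 + x ^ 3)) / 2 := by
    unfold SEinf; ring_nf
  have e3 : SOinf x = ((x ^ 2 + x ^ 3) / (1 - x ^ 2 - x ^ 3) - (x ^ 2 - x ^ 3) / (1 - x ^ 2 + x ^ 3)) / 2 := by
    unfold SOinf; ring_nf
  have eD : (1 - x ^ 4) ^ 2 * (1 - (x ^ 2 + x ^ 3)) * (1 - (x ^ 2 - x ^ 3)) =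
      (1 - x ^ 4) ^ 2 * (1 - x ^ 2 - x ^ 3) * (1 - x ^ 2 + x ^ 3) := by ring
  rw [EA, e1, e2, e3, eD]
  field_simp
  ring

/-- `B₂(x) = (54 − 60x²)/49` at any root of `1 − 4x² + 2x⁴` off the poles: `49 P_B − (54−60x²) Q =
(1 − 4x² + 2x⁴) Q₁` identically. [cite: DuminilCopinSmirnov2012, §3 (B_T)] -/
theorem limB_of_minpoly {x : ℝ} (h1 : 1 - x ^ 4 ≠ 0) (h2 : 1 - (x ^ 2 + x ^ 3) ≠ 0) (h3 : 1 - (x ^ 2 - x ^ 3) ≠ 0)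
    (hm : 1 - 4 * x ^ 2 + 2 * x ^ 4 = 0) : limB x = (54 - 60 * x ^ 2) / 49 := by
  have hD : (1 - x ^ 4) ^ 2 * (1 - (x ^ 2 + x ^ 3)) * (1 - (x ^ 2 - x ^ 3)) ≠ 0 :=
    mul_ne_zero (mul_ne_zero (pow_ne_zero 2 h1) h2) h3
  have hB := limB_mul_den h1 h2 h3
  have key : 49 * (4 * x ^ 4 - 8 * x ^ 8 + 4 * x ^ 10 + 4 * x ^ 12 - 2 * x ^ 14) -
      (54 - 60 * x ^ 2) * ((1 - x ^ 4) ^ 2 * (1 - (x ^ 2 + x ^ 3)) * (1 - (x ^ 2 - x ^ 3))) =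
      (1 - 4 * x ^ 2 + 2 * x ^ 4) *
        (-54 - 48 * x ^ 2 + 46 * x ^ 4 + 58 * x ^ 6 - 18 * x ^ 8 - 52 * x ^ 10 - 30 * x ^ 12) := by ring
  rw [hm, zero_mul, sub_eq_zero, ← hB, ← mul_assoc] at key
  have := mul_right_cancel₀ hD key
  rw [eq_div_iff (by norm_num : (49 : ℝ) ≠ 0)]
  linarith

/-- `E_A(x) = (45 − 50x²)/49` at any root of `1 − 4x² + 2x⁴` off the poles. [cite: DuminilCopinSmirnov2012, §3 (A_T)] -/
theorem EA_of_minpoly {x : ℝ} (h1 : 1 - x ^ 4 ≠ 0) (h2 : 1 - (x ^ 2 + x ^ 3) ≠ 0) (h3 : 1 - (x ^ 2 - x ^ 3) ≠ 0)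
    (hm : 1 - 4 * x ^ 2 + 2 * x ^ 4 = 0) : EA x = (45 - 50 * x ^ 2) / 49 := by
  have hD : (1 - x ^ 4) ^ 2 * (1 - (x ^ 2 + x ^ 3)) * (1 - (x ^ 2 - x ^ 3)) ≠ 0 :=
    mul_ne_zero (mul_ne_zero (pow_ne_zero 2 h1) h2) h3
  have hA := EA_mul_den h1 h2 h3
  have key : 49 * (x ^ 2 - x ^ 4 + x ^ 6 + 3 * x ^ 8 - 4 * x ^ 10 + x ^ 14) -
      (45 - 50 * x ^ 2) * ((1 - x ^ 4) ^ 2 * (1 - (x ^ 2 + x ^ 3)) * (1 - (x ^ 2 - x ^ 3))) =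
      (1 - 4 * x ^ 2 + 2 * x ^ 4) *
        (-45 + 9 * x ^ 2 + 22 * x ^ 4 - 66 * x ^ 6 + 34 * x ^ 8 + 22 * x ^ 10 - 25 * x ^ 12) := by ring
  rw [hm, zero_mul, sub_eq_zero, ← hA, ← mul_assoc] at key
  have := mul_right_cancel₀ hD key
  rw [eq_div_iff (by norm_num : (49 : ℝ) ≠ 0)]
  linarith

/-- **`B₂(x) = P_B(x)/Q(x)` as a rational function** off the poles:
`P_B = 4x⁴ − 8x⁸ + 4x¹⁰ + 4x¹² − 2x¹⁴`, `Q = (1−x⁴)²(1−x²−x³)(1−x²+x³) = 1 − 2x² − x⁴ + 3x⁶ − x⁸ + x¹² − x¹⁴`.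
[cite: DuminilCopinSmirnov2012, §3 (B_T)] -/
theorem limB_eq_div {x : ℝ} (h1 : 1 - x ^ 4 ≠ 0) (h2 : 1 - (x ^ 2 + x ^ 3) ≠ 0) (h3 : 1 - (x ^ 2 - x ^ 3) ≠ 0) :
    limB x = (4 * x ^ 4 - 8 * x ^ 8 + 4 * x ^ 10 + 4 * x ^ 12 - 2 * x ^ 14) /
      ((1 - x ^ 4) ^ 2 * (1 - (x ^ 2 + x ^ 3)) * (1 - (x ^ 2 - x ^ 3))) := by
  rw [eq_div_iff (mul_ne_zero (mul_ne_zero (pow_ne_zero 2 h1) h2) h3)]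
  exact limB_mul_den h1 h2 h3

/-- **`A₂(x) = 2x·E_A(x) = P_A(x)/Q(x)`** off the poles: `P_A = 2x³ − 2x⁵ + 2x⁷ + 6x⁹ − 8x¹¹ + 2x¹⁵`.
[cite: DuminilCopinSmirnov2012, §3 (A_T)] -/
theorem limA_eq_div {x : ℝ} (h1 : 1 - x ^ 4 ≠ 0) (h2 : 1 - (x ^ 2 + x ^ 3) ≠ 0) (h3 : 1 - (x ^ 2 - x ^ 3) ≠ 0) :
    2 * (x * EA x) = (2 * x ^ 3 - 2 * x ^ 5 + 2 * x ^ 7 + 6 * x ^ 9 - 8 * x ^ 11 + 2 * x ^ 15) /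
      ((1 - x ^ 4) ^ 2 * (1 - (x ^ 2 + x ^ 3)) * (1 - (x ^ 2 - x ^ 3))) := by
  rw [eq_div_iff (mul_ne_zero (mul_ne_zero (pow_ne_zero 2 h1) h2) h3)]
  have := EA_mul_den h1 h2 h3
  calc 2 * (x * EA x) * ((1 - x ^ 4) ^ 2 * (1 - (x ^ 2 + x ^ 3)) * (1 - (x ^ 2 - x ^ 3)))
      = 2 * x * (EA x * ((1 - x ^ 4) ^ 2 * (1 - (x ^ 2 + x ^ 3)) * (1 - (x ^ 2 - x ^ 3)))) := by ring
    _ = _ := by rw [this]; ring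

/-- **The `β`-family bound for all subcritical `x`**: for `0 ≤ x < 1` with `x² + x³ < 1`, any common
upper bound of the `B_{2,L}(x)` is at least `B₂(x) = P_B(x)/Q(x)` (the walks of the family are bridges of the
width-two strip, at every fugacity). [cite: DuminilCopinSmirnov2012, §3 (B_{T,L}, B_T)] -/
theorem limB_le_of_stripB_le {x c : ℝ} (hx0 : 0 ≤ x) (hx1 : x < 1) (ha : x ^ 2 + x ^ 3 < 1)
    (h : ∀ L : ℕ, stripB 2 L x ≤ c) : limB x ≤ c :=
  le_of_tendsto' (tendsto_sum_paramsB hx0 hx1 ha) fun N => (sum_paramsB_le_stripB hx0 N).trans (h _)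

/-- **The `α`-family bound for all subcritical `x`**: any common upper bound of the `A_{2,L}(x)` is at
least `A₂(x) = 2x E_A(x) = P_A(x)/Q(x)`. [cite: DuminilCopinSmirnov2012, §3 (A_{T,L}, A_T)] -/
theorem limA_le_of_stripA_le {x c : ℝ} (hx0 : 0 ≤ x) (hx1 : x < 1) (ha : x ^ 2 + x ^ 3 < 1)
    (h : ∀ L : ℕ, stripA 2 L x ≤ c) : 2 * (x * EA x) ≤ c :=
  le_of_tendsto' (tendsto_sum_paramsA hx0 hx1 ha) fun N => (sum_paramsA_le_stripA hx0 N).trans (h _)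

/-- **`B₂(x_c) = (54 − 60x_c²)/49`**. [cite: DuminilCopinSmirnov2012, §3 (B_T)] -/
theorem limB_xc : limB hexCriticalFugacity = (54 - 60 * hexCriticalFugacity ^ 2) / 49 := by
  obtain ⟨h1, h2, h3⟩ := xc_denoms
  exact limB_of_minpoly h1 h2 h3 minpoly_xc

/-- **`E_A(x_c) = (45 − 50x_c²)/49`**. [cite: DuminilCopinSmirnov2012, §3 (A_T)] -/
theorem EA_xc : EA hexCriticalFugacity = (45 - 50 * hexCriticalFugacity ^ 2) / 49 := by
  obtain ⟨h1, h2, h3⟩ := xc_denoms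
  exact EA_of_minpoly h1 h2 h3 minpoly_xc

end W2

/-! ### §10. The theorems: `B₂(x_c) = (30√2 − 6)/49` and `A₂(x_c) = x_c(50√2 − 10)/49` -/

open W2 in

/-- **Lower bound from the `β`-family**: `B₂(x_c) ≥ limB(x_c)`. [cite: DuminilCopinSmirnov2012, §3 (B_T)] -/
theorem limB_le_stripBlim : limB hexCriticalFugacity ≤ stripBlim 2 := by
  obtain ⟨h0, h1⟩ := hexCriticalFugacity_pos_lt_one
  refine le_of_tendsto' (tendsto_sum_paramsB h0.le h1 xc_weave_lt_one) fun N => ?_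
  exact (sum_paramsB_le_stripB h0.le N).trans (stripB_le_lim DuminilCopinSmirnov2012_lemma2_holds (by norm_num) _)

open W2 in
/-- **Lower bound from the `α`-family**: `A₂(x_c) ≥ 2x_c E_A(x_c)`. [cite: DuminilCopinSmirnov2012, §3 (A_T)] -/
theorem limA_le_stripAlim : 2 * (hexCriticalFugacity * EA hexCriticalFugacity) ≤ stripAlim 2 := by
  obtain ⟨h0, h1⟩ := hexCriticalFugacity_pos_lt_one
  refine le_of_tendsto' (tendsto_sum_paramsA h0.le h1 xc_weave_lt_one) fun N => ?_
  exact (sum_paramsA_le_stripA h0.le N).trans (stripA_le_lim DuminilCopinSmirnov2012_lemma2_holds (by norm_num) _)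

open W2 in
/-- **`B₂(x_c) = (30√2 − 6)/49`** — the exact value of Duminil-Copin–Smirnov's width-two strip bridge
partition function at criticality (lane «pcv-sawmu» R54 (ii), planner statement `HV.stripBlim_two_eq`):
the `β`-family gives `B₂ ≥ (30√2−6)/49`, the `α`-family gives `A₂ ≥ x_c(50√2−10)/49`, and the strip identity
`cos(3π/8) A₂ + B₂ = 1` (tree `strip_identity_lim`, `E₂ = 0`) closes both: `cos(3π/8)·x_c(50√2−10)/49 + (30√2−6)/49
= 1`. The rational generating function `B(z)` of this strip was reported without proof by Beaton–Guttmann–Jensen;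
its value at `x_c` is the number proved here. [cite: DuminilCopinSmirnov2012, §3 (B_T, Lemma 2, proof of Theorem 1); BeatonGuttmannJensen2012, §2 (B_1(z), their width 1 = width 2 here)] -/
theorem stripBlim_two_eq : stripBlim 2 = (30 * Real.sqrt 2 - 6) / 49 := by
  have hid := strip_identity_lim (T := 2) (by norm_num)
  have hlow := limB_le_stripBlim
  have hA := limA_le_stripAlim
  have hc := cos_three_pi_div_eight_pos
  have hcx := cos_mul_xc
  rw [limB_xc] at hlow
  rw [EA_xc] at hA
  have hs := sqrt_two_eq
  -- upper bound: `B₂ = 1 − c_α A₂ ≤ 1 − c_α · 2 x_c E_A = (54 − 60 x_c²)/49`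
  have hup : stripBlim 2 ≤ (54 - 60 * hexCriticalFugacity ^ 2) / 49 := by
    have h1 : Real.cos (3 * Real.pi / 8) * (2 * (hexCriticalFugacity * ((45 - 50 * hexCriticalFugacity ^ 2) / 49))) ≤
        Real.cos (3 * Real.pi / 8) * stripAlim 2 := mul_le_mul_of_nonneg_left hA hc.le
    have h2 : Real.cos (3 * Real.pi / 8) * (2 * (hexCriticalFugacity * ((45 - 50 * hexCriticalFugacity ^ 2) / 49))) =
        (1 - 2 * hexCriticalFugacity ^ 2) * (45 - 50 * hexCriticalFugacity ^ 2) / 49 := by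
      have : Real.cos (3 * Real.pi / 8) * (2 * (hexCriticalFugacity * ((45 - 50 * hexCriticalFugacity ^ 2) / 49))) =
          2 * (Real.cos (3 * Real.pi / 8) * hexCriticalFugacity) * ((45 - 50 * hexCriticalFugacity ^ 2) / 49) := by ring
      rw [this, hcx]; ring
    have hm := minpoly_xc
    nlinarith
  have heq : stripBlim 2 = (54 - 60 * hexCriticalFugacity ^ 2) / 49 := le_antisymm hup hlow
  rw [heq, hs]; ring

open W2 in
/-- **`A₂(x_c) = x_c (50√2 − 10)/49`** (`= 5√(2+√2)(11√2 − 12)/49 = 0.67053…`), the exact value of the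
width-two escape partition function `A_T = sup_L A_{T,L}(x_c)` at `T = 2`.
[cite: DuminilCopinSmirnov2012, §3 (A_T, Lemma 2); BeatonGuttmannJensen2012, §2 (A_1(z), their width 1 = width 2 here)] -/
theorem stripAlim_two_eq : stripAlim 2 = hexCriticalFugacity * (50 * Real.sqrt 2 - 10) / 49 := by
  have hid := strip_identity_lim (T := 2) (by norm_num)
  have hB := stripBlim_two_eq
  have hc := cos_three_pi_div_eight_pos
  have hcx := cos_mul_xc
  have hs := sqrt_two_eq
  have hm := minpoly_xc
  obtain ⟨h0, -⟩ := hexCriticalFugacity_pos_lt_one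
  -- `c_α A₂ = 1 − B₂`, and `c_α = (1 − 2x_c²)/(2 x_c)`
  have h1 : Real.cos (3 * Real.pi / 8) * stripAlim 2 = 1 - stripBlim 2 := by linarith
  have hcval : Real.cos (3 * Real.pi / 8) = (1 - 2 * hexCriticalFugacity ^ 2) / (2 * hexCriticalFugacity) := by
    field_simp
    linarith
  rw [hcval, hB, hs] at h1
  have hne : (1 - 2 * hexCriticalFugacity ^ 2) ≠ 0 := by
    intro h; nlinarith
  field_simp at h1
  field_simp
  nlinarith [h1, hm, sq_nonneg hexCriticalFugacity]

end HV

end Literature.Probability.RandomPlanarGeometry.SAW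

end
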